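import Literature.NumberTheory.EllipticCurves.Kato2004.Condition1252
import Literature.NumberTheory.EllipticCurves.OrdinaryReductionTateModuleProofs
import Literature.NumberTheory.EllipticCurves.IsogenyFrobeniusTraceProofs
import Literature.NumberTheory.EllipticCurves.TateModuleFixedPointsProofs
import Literature.NumberTheory.EllipticCurves.Wuthrich2014.ThreeAdicImage
import Literature.NumberTheory.EllipticCurves.MultiplicativeReductionInertiaShapeProofs
import Literature.NumberTheory.EllipticCurves.TamagawaPrimesEquivProofs
import Literature.NumberTheory.EllipticCurves.OpenImageMazurTwistProofs
import HarnessLib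

/-!
# Wuthrich 2014, Lemma 20 — the ORDINARY cases PROVED: at an odd prime `p` of good ordinary or
# multiplicative reduction, `ρ̄_{E,p}` onto `GL₂(𝔽_p)` ⟹ `ρ̄_{E,p^n}` onto for every `n`
# (Kato's (12.5.2))

`Proofs` file (theorems only: no definition, no named fact, debt 0), topic
`NumberTheory/EllipticCurves`, sibling of `Wuthrich2014/ThreeAdicImage.lean`, whose ONE named fact
`Wuthrich2014.lemma20_surjective_threeAdic_of_semistable` (C. Wuthrich, Doc. Math. 19 (2014),
Lemma 20, p. 399: "Let `p = 3` and suppose `p²` does not divide the conductor `N`. If the residual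
representation `ρ̄ : Gal(ℚ̄/ℚ) → GL₂(𝔽_p)` is surjective then the `p`-adic representation
`ρ : Gal(ℚ̄/ℚ) → GL₂(ℤ_p)` is surjective, too.") is the `3`-adic-tower input of every `p = 3`
consumer of Kato's integral divisibility (Kato 2004, Thm. 17.4 (3) under (12.5.2)) in the cell
`bsd-rank1-residual` (class X10 = `3` good ordinary, `E[3]` irreducible; the `p = 3` corners of the
partition; the `X11`/`AdditivePotMult`/`Gord` descent files).  The printed proof (pp. 399–400) runs
through Elkies' explicit parametrisation of the curves with `ρ̄_{E,3}` onto and `ρ_{E,9}` not onto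
(arXiv:math/0612734) and is not formalisable with the tree's means.

THIS FILE PROVES THE GOOD *ORDINARY* CASE of the lemma — which is the whole of its use on class X10 —
by a different, purely local-at-`p` argument, at EVERY odd prime `p` (at `p ≥ 5` the conclusion
already follows from `surj(p)` alone by Serre's lifting lemma, tree theorem
`serre_hasSurjectiveModNGaloisRep_pow_holds`; the point is `p = 3`):

* `WeierstrassCurve.forall_hasSurjectiveModNGaloisRep_pow_of_goodOrdinary_of_surj` — `E/ℚ` given by a
  globally minimal `W`, `p` odd, `p` of good ORDINARY reduction (`p ∤ N`, `p ∤ a_p`), `ρ̄_{E,p}` onto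
  ⟹ `ρ̄_{E,p^n}` onto for all `n`;
* `WeierstrassCurve.forall_hasSurjectiveModNGaloisRep_three_pow_of_goodOrdinary_of_surj` — the case
  `p = 3`, in the binder shape of the named fact (`∀ n, HasSurjectiveModNGaloisRep (3 ^ n)`);
* `Literature.NumberTheory.EllipticCurves.Kato2004.imageContainsSL2_of_goodOrdinary_of_surj` —
  Kato's printed hypothesis (12.5.2) (`Kato2004/Condition1252.lean`) holds at every odd good
  ordinary prime with `ρ̄_{E,p}` onto: on the good-ordinary locus the image hypothesis of the
  integral divisibility Kato Thm. 17.4 (3) is decided by the census bit `surj(p)` alone.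

The MULTIPLICATIVE case (`p ≠ 2` of multiplicative reduction, `ρ̄_{E,p}` onto ⟹ the tower) is
proved in the Appendix at the end of this file (second landing of the same unit), with the Tate
line of the Tate form in place of the Serre–Tate line:
`WeierstrassCurve.forall_hasSurjectiveModNGaloisRep_pow_of_multiplicative_of_surj`,
`…_three_pow_of_multiplicative_of_surj`, and the combined
`…_three_pow_of_not_additive_of_not_supersingular` (Lemma 20 off the good-supersingular locus).
Appendix B (third landing) records the inertia-triangular basis as standalone statements
(`WeierstrassCurve.exists_basis_inertia_upperTriangular_of_goodOrdinary`,
`…_of_multiplicative`) and DESCENDS THE TOWER ALONG QUADRATIC TWISTS: if `W'` is good ordinary or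
multiplicative at the odd `p` and `f : W'(ℚ̄) ≃+ W(ℚ̄)` commutes with all `σ²` (a quadratic-twist
isomorphism does), then `ρ̄_{W,p}` onto ⟹ `ρ̄_{W,p^n}` onto for all `n`, with no hypothesis on the
reduction of `W` at `p` (`…_of_upperTriangular_of_sqEquivariant`,
`…_pow_of_sqEquivariant_of_{goodOrdinary,multiplicative}`,
`…_pow_of_twistModel_{goodOrdinary,multiplicative}`) — the additive potentially-ordinary (`e = 2`)
and potentially-multiplicative primes of the classes X3/X4.
NOT proved here (the named fact keeps it): the good SUPERSINGULAR case at `3` (`3 ∤ N`, `3 ∣ a_3`),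
where the level-`9` inertia structure of a height-`2` formal group would be needed.

## The argument (all inputs are tree THEOREMS)

1. Serre–Tate / Greenberg: at a place `v ∣ p` of good ordinary reduction `V_pE` has a
   `Γ_{ℚ_v}`-stable line `L` on which the inertia group `I_{ℚ_v}` acts through the cyclotomic
   character `χ_p` and such that `I_{ℚ_v}` acts trivially on `V_pE/L`
   (`ellipticOrdinaryReduction_tateModule_filtration_holds`, Greenberg 1991 §2; Serre 1972 §1.11).
2. `L ∩ T_pE` is a saturated `ℤ_p`-line of the free rank-two `ℤ_p`-module `T_pE`; a primitive
   vector `e₀` of it extends to a `ℤ_p`-basis `(e₀, e₁)` of `T_pE` (`T_pE` is `p`-adically separated,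
   `TateModule.instIsHausdorff`; `T_pE ↪ V_pE`, `TateModule.toRational_injective`), and in this basis
   every `τ ∈ I_{ℚ_v}` acts as `(χ_p(τ), *; 0, 1)`.
3. `χ_p(I_{ℚ_v}) = ℤ_pˣ` (`ℚ_p(μ_{p^∞})/ℚ_p` totally ramified; tree theorem
   `adicCompletion_rat_exists_mem_absInertia_cyclotomicCharacter_eq`): pick `σ₄, σ₋ ∈ I_{ℚ_v}` with
   `χ_p(σ₄) = 1 + p`, `χ_p(σ₋) = -1`, acting as `g₄ = (1+p, b; 0, 1)`, `g₋ = (-1, d; 0, 1)`.  Then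
   (`word_eq`) `g₄ g₋ g₄ g₋ = 1 + p·(2, -(b+d); 0, 0) + p²·(1, -d; 0, 0)`: the element
   `τ = σ₄ σ₋ σ₄ σ₋` acts on `T_pE` as `1 + p M₀ + p² V` with `M₀ = (2, *; 0, 0)` NON-SCALAR modulo `p`
   and of UNIT trace (`p` odd) — a "first-order witness".
4. The cell's kernel theorem `forall_hasSurjectiveModNGaloisRep_of_firstOrderWitness`
   (`Kato2004/Condition1252.lean`, unit `b2b-bsdres-lit-kato` gen 6: `surj(p)` + one first-order
   witness ⟹ the whole tower, via the `GL₂(𝔽_p)`-stable subgroups of `M₂(𝔽_p)` and Serre's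
   induction IV-23) concludes.

So at `p = 3` no appeal to Elkies' modular curve `X(9)/G` is needed on the ordinary locus: the
exotic `3`-adic images (index `27`, first-order kernel = scalars) contain no element `(4, 3b'; 0, 1)`,
and the inertia group at a good ordinary `3` always supplies one.

presearch (2026-08-21, corpus + galaxy): `lit search --hybrid` / `lit vsearch` ("surjective mod 3 ⟹
3-adic surjective at an ordinary prime; inertia element ≡ 1 mod 3 not mod 9") → Cornell–Silverman–
Stevens 1997 pp. 669–672 and Silverman AEC/ATAEC (Serre's criterion, `p ≥ 5` only), Wuthrich 2014
Lemma 20 (Elkies route); `lit galaxy search "surjective mod 9|image contains SL2(Z_3)|3-adic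
representation is surjective" --star all` → 0 hits.  No printed source states the ordinary-locus
argument above; it is recorded here as a proof of (a case of) the cited lemma, not as a new fact.

## References

* [Wuthrich2014] C. Wuthrich, Doc. Math. 19 (2014) 381–402, Lemma 20 (p. 399), Cor. 19.
* [Greenberg1991] R. Greenberg, *Iwasawa theory for motives*, LMS LNS 153 (1991), §2 (p. 214).
* [SerreInventiones1972] J.-P. Serre, Invent. Math. 15 (1972), §1.11 Prop. 11 and Cor.
* [SerreAbelianLadic1968] J.-P. Serre, *Abelian ℓ-adic representations* (1968), IV-23 Lemma 3, §3.4.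
* [SerreLocalFields1979] J.-P. Serre, *Local Fields*, Ch. IV §4 Prop. 17 (`χ_p(I) = ℤ_pˣ`).
* [Kato2004Asterisque] K. Kato, Astérisque 295 (2004), (12.5.2) in Thm. 12.5 (4) (p. 222);
  Thm. 17.4 (3) (p. 273).
* [SilvermanAEC2009] J. H. Silverman, *The Arithmetic of Elliptic Curves*, 2nd ed. (2009), X.5
  Cor. 5.4 (quadratic twists become isomorphic over `ℚ(√d)`).
* [Elkies2006] N. D. Elkies, arXiv:math/0612734 (the exotic `3`-adic images; not used).
-/

noncomputable section

open scoped Classical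
open Field

namespace WeierstrassCurve

open Literature.NumberTheory.EllipticCurves Literature.NumberTheory.GaloisRepresentations
  NumberField IsDedekindDomain

/-! ### Rank two: a vector with a unit coordinate extends to a basis -/

section Basis

variable {R : Type*} [CommRing R] {M : Type*} [AddCommGroup M] [Module R M]

/-- If `b = (b₀, b₁)` is a basis of `M` and `t = x b₀ + y b₁` with `x` a unit, then `(t, b₁)` is a
basis of `M`. [folklore] -/
private theorem exists_basis_eq_of_isUnit_repr_zero (b : Module.Basis (Fin 2) R M) (t : M)
    (hx : IsUnit (b.repr t 0)) : ∃ e : Module.Basis (Fin 2) R M, e 0 = t ∧ e 1 = b 1 := by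
  have ht : t = b.repr t 0 • b 0 + b.repr t 1 • b 1 := by
    conv_lhs => rw [← b.sum_repr t]
    rw [Fin.sum_univ_two]
  have hli : LinearIndependent R ![t, b 1] := by
    rw [LinearIndependent.pair_iff]
    intro s s' hs
    have h0 := congrArg (fun m => b.repr m 0) hs
    have h1 := congrArg (fun m => b.repr m 1) hs
    simp only [map_add, map_smul, Finsupp.coe_add, Finsupp.coe_smul, Pi.add_apply, Pi.smul_apply,
      Module.Basis.repr_self, Finsupp.single_apply, map_zero, Finsupp.coe_zero, Pi.zero_apply,
      smul_eq_mul] at h0 h1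
    norm_num at h0 h1
    have hs0 : s = 0 := by
      obtain ⟨u, hu⟩ := hx
      rw [← hu] at h0
      simpa using congrArg (· * (u⁻¹ : Rˣ).val) h0
    refine ⟨hs0, ?_⟩
    rw [hs0, zero_mul, zero_add] at h1
    exact h1
  have hsp : ⊤ ≤ Submodule.span R (Set.range ![t, b 1]) := by
    rw [← b.span_eq, Submodule.span_le]
    rintro _ ⟨i, rfl⟩
    have h1 : b 1 ∈ Submodule.span R (Set.range ![t, b 1]) :=
      Submodule.subset_span ⟨1, rfl⟩
    have h0 : t ∈ Submodule.span R (Set.range ![t, b 1]) :=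
      Submodule.subset_span ⟨0, rfl⟩
    fin_cases i
    · obtain ⟨u, hu⟩ := hx
      have e : (u⁻¹ : Rˣ) • (t - b.repr t 1 • b 1) = b 0 := by
        have e1 : t - b.repr t 1 • b 1 = u • b 0 := by
          rw [Units.smul_def, hu]
          exact sub_eq_of_eq_add ht
        rw [e1, inv_smul_smul]
      have hmem : (u⁻¹ : Rˣ) • (t - b.repr t 1 • b 1) ∈ Submodule.span R (Set.range ![t, b 1]) := by
        rw [Units.smul_def]
        exact Submodule.smul_mem _ _ (Submodule.sub_mem _ h0 (Submodule.smul_mem _ _ h1))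
      rw [e] at hmem
      simpa using hmem
    · exact h1
  exact ⟨Module.Basis.mk hli hsp, by simp [Module.Basis.mk_apply], by simp [Module.Basis.mk_apply]⟩

/-- Over `ℤ_p`: an element outside `p M` of a free rank-two module `M` (given a basis `b`) extends
to a basis: one of its coordinates is a unit of the local ring `ℤ_p`. [folklore] -/
private theorem exists_basis_eq_of_not_dvd {p : ℕ} [Fact p.Prime] {N : Type*} [AddCommGroup N]
    [Module ℤ_[p] N] (b : Module.Basis (Fin 2) ℤ_[p] N) (t : N)
    (ht : ¬ ∃ s : N, (p : ℤ_[p]) • s = t) : ∃ e : Module.Basis (Fin 2) ℤ_[p] N, e 0 = t := by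
  by_cases h0 : IsUnit (b.repr t 0)
  · obtain ⟨e, he, -⟩ := exists_basis_eq_of_isUnit_repr_zero b t h0
    exact ⟨e, he⟩
  by_cases h1 : IsUnit (b.repr t 1)
  · have h1' : IsUnit ((b.reindex (Equiv.swap 0 1)).repr t 0) := by
      rw [Module.Basis.repr_reindex_apply]
      exact h1
    obtain ⟨e, he, -⟩ := exists_basis_eq_of_isUnit_repr_zero (b.reindex (Equiv.swap 0 1)) t h1'
    exact ⟨e, he⟩
  exfalso
  rw [PadicInt.isUnit_iff] at h0 h1
  have hlt0 : ‖b.repr t 0‖ < 1 := lt_of_le_of_ne (PadicInt.norm_le_one _) h0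
  have hlt1 : ‖b.repr t 1‖ < 1 := lt_of_le_of_ne (PadicInt.norm_le_one _) h1
  obtain ⟨x, hx⟩ := (PadicInt.norm_lt_one_iff_dvd _).mp hlt0
  obtain ⟨y, hy⟩ := (PadicInt.norm_lt_one_iff_dvd _).mp hlt1
  apply ht
  refine ⟨x • b 0 + y • b 1, ?_⟩
  conv_rhs => rw [← b.sum_repr t]
  rw [Fin.sum_univ_two, hx, hy, smul_add, smul_smul, smul_smul]

end Basis

/-! ### The primitive part of a non-zero element of a Tate module -/

section Primitive

variable {A : Type*} [AddCommGroup A] {p : ℕ} [Fact p.Prime]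

/-- A non-zero element of `T_p A` is `p^k t` with `t ∉ p T_p A` (`T_p A` is `p`-adically
separated). [folklore] -/
private theorem exists_pow_smul_eq_not_dvd {x : TateModule A p} (hx : x ≠ 0) :
    ∃ (k : ℕ) (t : TateModule A p), ((p : ℤ_[p]) ^ k) • t = x ∧
      ¬ ∃ s : TateModule A p, (p : ℤ_[p]) • s = t := by
  by_contra h
  push Not at h
  have hall : ∀ k : ℕ, ∃ t : TateModule A p, ((p : ℤ_[p]) ^ k) • t = x := by
    intro k
    induction k with
    | zero => exact ⟨x, by rw [pow_zero, one_smul]⟩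
    | succ k ih =>
      obtain ⟨t, ht⟩ := ih
      obtain ⟨s, hs⟩ := h k t ht
      exact ⟨s, by rw [pow_succ, mul_smul, hs, ht]⟩
  apply hx
  refine IsHausdorff.haus (TateModule.instIsHausdorff (A := A) (p := p)) x fun n ↦ ?_
  obtain ⟨t, ht⟩ := hall n
  rw [SModEq.zero, ← ht]
  refine Submodule.smul_mem_smul (Ideal.pow_mem_pow ?_ n) Submodule.mem_top
  rw [PadicInt.maximalIdeal_eq_span_p]
  exact Ideal.mem_span_singleton_self _

end Primitive

/-! ### A `2 × 2` identity -/

section MatrixIdentity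

variable {R : Type*} [CommRing R]

/-- The word `g₄ gm g₄ gm` on upper-triangular matrices `g₄ = (1+q, b; 0, 1)`, `gm = (-1, d; 0, 1)`:
`(1+q, b; 0, 1)(-1, d; 0, 1)(1+q, b; 0, 1)(-1, d; 0, 1) = 1 + q (2, -(b+d); 0, 0) + q² (1, -d; 0, 0)`.
[folklore] -/
private theorem word_eq (q b d : R) :
    !![1 + q, b; 0, 1] * !![-1, d; 0, 1] * !![1 + q, b; 0, 1] * !![-1, d; 0, 1] =
      1 + q • !![2, -(b + d); 0, 0] + q ^ 2 • !![1, -d; 0, 0] := by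
  ext i j
  fin_cases i <;> fin_cases j <;>
    simp [Matrix.mul_apply, Fin.sum_univ_two, Matrix.add_apply] <;> ring

/-- `2` is a unit of `ℤ_p` for odd `p`. [folklore] -/
private theorem isUnit_two' {p : ℕ} [Fact p.Prime] (hp2 : p ≠ 2) : IsUnit (2 : ℤ_[p]) := by
  have hp : p.Prime := Fact.out
  rw [PadicInt.isUnit_iff]
  have h1 : ‖((2 : ℤ) : ℤ_[p])‖ = 1 := by
    refine le_antisymm (PadicInt.norm_le_one _) (not_lt.mp fun hlt ↦ ?_)
    have hdvd : (p : ℤ) ∣ 2 := (PadicInt.norm_int_lt_one_iff_dvd 2).mp hlt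
    have : p ∣ 2 := by exact_mod_cast hdvd
    exact hp2 ((Nat.prime_dvd_prime_iff_eq hp Nat.prime_two).mp this)
  simpa using h1

end MatrixIdentity

/-! ### The theorem -/

variable (W : WeierstrassCurve ℚ) [W.IsElliptic] (p : ℕ) [Fact p.Prime]

set_option maxHeartbeats 800000 in
/-- **Mod-`p` surjectivity lifts to the whole `p`-adic tower at an odd prime of good ORDINARY
reduction.**  Let `E/ℚ` be given by a globally minimal `W`, `p ≠ 2` a prime of good ordinary
reduction (`W.HasGoodReductionAtPrime p`, `p ∤ a_p = W.frobeniusTrace p`), and suppose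
`ρ̄_{E,p} : Γ_ℚ → Aut(E[p])` is onto.  Then `ρ̄_{E,p^n} : Γ_ℚ → Aut(E[p^n])` is onto for every `n`,
i.e. `ρ_{E,p^∞}(Γ_ℚ) = GL₂(ℤ_p)`.  At `p = 3` this is the good-ordinary case of Wuthrich 2014,
Lemma 20 (p. 399); at `p ≥ 5` it is Serre IV-23.  Proof: the inertia group at `p` acts on `T_pE`
through `(χ_p, *; 0, 1)` in a basis adapted to the Serre–Tate line (Greenberg 1991 §2, tree theorem
`ellipticOrdinaryReduction_tateModule_filtration_holds`), `χ_p(I_p) = ℤ_pˣ`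
(`adicCompletion_rat_exists_mem_absInertia_cyclotomicCharacter_eq`), and for `χ_p(σ₄) = 1 + p`,
`χ_p(σ₋) = -1` the element `σ₄σ₋σ₄σ₋` is a first-order witness
(`forall_hasSurjectiveModNGaloisRep_of_firstOrderWitness`).  See the module docstring.
[cite: Wuthrich2014, Lemma 20 (p. 399)] [cite: Greenberg1991, §2 (p. 214)]
[cite: SerreAbelianLadic1968, Ch. IV §3.4, Lemma 3 (IV-23)]
[cite: SerreLocalFields1979, Ch. IV §4 Prop. 17] -/
theorem forall_hasSurjectiveModNGaloisRep_pow_of_goodOrdinary_of_surj [W.IsGloballyMinimal]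
    (hp2 : p ≠ 2) (hgood : W.HasGoodReductionAtPrime p) (hord : ¬ (p : ℤ) ∣ W.frobeniusTrace p)
    (hsurj : W.HasSurjectiveModNGaloisRep p) (n : ℕ) :
    W.HasSurjectiveModNGaloisRep (p ^ n : ℕ) := by
  have hp : p.Prime := Fact.out
  have hp0 : (p : ℚ) ≠ 0 := Nat.cast_ne_zero.mpr hp.ne_zero
  -- the place of `ℚ` at `p`
  set v : HeightOneSpectrum (𝓞 ℚ) := (Rat.HeightOneSpectrum.primesEquiv (R := 𝓞 ℚ)).symm ⟨p, hp⟩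
    with hv_def
  have hv : (p : 𝓞 ℚ) ∈ v.asIdeal :=
    (natCast_mem_asIdeal_iff_eq_primesEquiv_symm v hp).mpr rfl
  have hpe : (Rat.HeightOneSpectrum.primesEquiv v : ℕ) = p := by
    rw [hv_def, Equiv.apply_symm_apply]
  have hgoodv : W.HasGoodReductionAt v :=
    (hasGoodReductionAtPrime_primesEquiv_iff_holds W v p hpe).mp hgood
  have hordv : ¬ ((p : ℤ) ∣ W.frobeniusTraceAt v) := by
    rw [frobeniusTraceAt_eq_frobeniusTrace, hpe]; exact hord
  -- Greenberg's ordinary line `L ⊆ V_pE`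
  obtain ⟨L, hL1, -, hLχ, hLq⟩ :=
    ellipticOrdinaryReduction_tateModule_filtration_holds W p v hv hgoodv hordv
  -- `T_pE ↪ V_pE` and its compatibilities
  let ι : W.tateModule p →ₗ[ℤ_[p]] W.rationalTateModule p := TateModule.toRational p
  have hι : Function.Injective ι := TateModule.toRational_injective
  have hιρ : ∀ (g : absoluteGaloisGroup ℚ) (x : W.tateModule p),
      W.rationalGaloisRepTate p g (ι x) = ι (W.galoisRepTate p g x) := fun _ _ ↦ rfl
  have hιsmul : ∀ (c : ℤ_[p]) (x : W.tateModule p), (c : ℚ_[p]) • ι x = ι (c • x) := by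
    intro c x
    rw [map_smul]
    exact algebraMap_smul ℚ_[p] c (ι x)
  -- the integral line `LT = T_pE ∩ L`
  let LT : Submodule ℤ_[p] (W.tateModule p) := (L.restrictScalars ℤ_[p]).comap ι
  have hmemLT : ∀ x : W.tateModule p, x ∈ LT ↔ ι x ∈ L := fun _ ↦ Iff.rfl
  have hpQ : ((p : ℤ_[p]) : ℚ_[p]) ≠ 0 := by
    rw [PadicInt.coe_natCast]; exact Nat.cast_ne_zero.mpr hp.ne_zero
  -- `LT` is saturated
  have hsat : ∀ x : W.tateModule p, (p : ℤ_[p]) • x ∈ LT → x ∈ LT := by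
    intro x hx
    rw [hmemLT] at hx ⊢
    rw [← hιsmul] at hx
    have h := L.smul_mem ((p : ℤ_[p]) : ℚ_[p])⁻¹ hx
    rwa [smul_smul, inv_mul_cancel₀ hpQ, one_smul] at h
  have hsat' : ∀ (k : ℕ) (x : W.tateModule p), ((p : ℤ_[p]) ^ k) • x ∈ LT → x ∈ LT := by
    intro k
    induction k with
    | zero => intro x hx; rwa [pow_zero, one_smul] at hx
    | succ k ih =>
      intro x hx
      rw [pow_succ, mul_smul] at hx
      exact hsat x (ih _ hx)
  -- a non-zero element of `LT`
  obtain ⟨x₁, hx₁LT, hx₁0⟩ : ∃ x ∈ LT, x ≠ 0 := by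
    haveI : Module.Finite ℚ_[p] L := Module.finite_of_finrank_eq_succ hL1
    let bL : Module.Basis (Fin 1) ℚ_[p] L := Module.finBasisOfFinrankEq ℚ_[p] L hL1
    have hℓ0 : (bL 0 : W.rationalTateModule p) ≠ 0 := fun h ↦
      bL.ne_zero 0 (Subtype.ext h)
    obtain ⟨N, hN, x, hx⟩ :=
      RationalTateModule.exists_smul_eq_toRational (bL 0 : W.rationalTateModule p)
    have hN' : (N : ℚ_[p]) ≠ 0 := PadicInt.coe_ne_zero.mpr hN
    refine ⟨x, ?_, ?_⟩
    · rw [hmemLT]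
      change TateModule.toRational p x ∈ L
      rw [← hx]
      exact L.smul_mem _ (bL 0).2
    · intro hx0
      rw [hx0, LinearMap.map_zero] at hx
      exact hℓ0 ((smul_eq_zero.mp hx).resolve_left hN')
  -- its primitive part `t₀`
  obtain ⟨k, t₀, hkt₀, ht₀⟩ := exists_pow_smul_eq_not_dvd hx₁0
  have ht₀LT : t₀ ∈ LT := hsat' k t₀ (by rw [hkt₀]; exact hx₁LT)
  -- a basis `e = (t₀, e₁)` of `T_pE`
  haveI : Module.Free ℤ_[p] (W.tateModule p) := module_free_tateModule_holds W p
  haveI : Module.Finite ℤ_[p] (W.tateModule p) := module_finite_tateModule_holds W p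
  let b₀ : Module.Basis (Fin 2) ℤ_[p] (W.tateModule p) :=
    Module.finBasisOfFinrankEq ℤ_[p] (W.tateModule p) (finrank_tateModule_eq_two_holds W p hp0)
  obtain ⟨e, he0⟩ := exists_basis_eq_of_not_dvd b₀ t₀ ht₀
  have he0LT : e 0 ∈ LT := by rw [he0]; exact ht₀LT
  have he0L : ι (e 0) ∈ L := (hmemLT _).mp he0LT
  -- not every lattice vector lies on the line (`dim L = 1 < 2 = dim V_pE`)
  have hV2 : Module.finrank ℚ_[p] (W.rationalTateModule p) = 2 :=
    finrank_rationalTateModule_eq_two_holds W p hp0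
  have hnotall : ¬ ∀ z : W.tateModule p, ι z ∈ L := by
    intro hall
    have hLtop : L = ⊤ := by
      refine eq_top_iff.mpr fun w _ ↦ ?_
      obtain ⟨N, hN, z, hz⟩ := RationalTateModule.exists_smul_eq_toRational w
      have hN' : (N : ℚ_[p]) ≠ 0 := PadicInt.coe_ne_zero.mpr hN
      have hw : w = (N : ℚ_[p])⁻¹ • ι z := by
        rw [← hz, smul_smul, inv_mul_cancel₀ hN', one_smul]
      rw [hw]
      exact L.smul_mem _ (hall z)
    have h2 : Module.finrank ℚ_[p] L = 2 := by rw [hLtop, finrank_top, hV2]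
    omega
  -- `LT = ℤ_p e₀`: the second coordinate of an element of `LT` vanishes
  have hrepr1 : ∀ y ∈ LT, e.repr y 1 = 0 := by
    intro y hy
    by_contra hc
    apply hnotall
    have hy' : e.repr y 0 • e 0 + e.repr y 1 • e 1 = y := by
      conv_rhs => rw [← e.sum_repr y]
      rw [Fin.sum_univ_two]
    have h1 : (e.repr y 1 : ℚ_[p]) • ι (e 1) ∈ L := by
      have hmem : ι (e.repr y 1 • e 1) ∈ L := by
        rw [eq_sub_of_add_eq' hy', map_sub, map_smul]
        exact (L.restrictScalars ℤ_[p]).sub_mem ((hmemLT y).mp hy)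
          ((L.restrictScalars ℤ_[p]).smul_mem _ he0L)
      rwa [hιsmul]
    have hc' : (e.repr y 1 : ℚ_[p]) ≠ 0 := PadicInt.coe_ne_zero.mpr hc
    have he1L : ι (e 1) ∈ L := by
      have h := L.smul_mem ((e.repr y 1 : ℚ_[p]))⁻¹ h1
      rwa [smul_smul, inv_mul_cancel₀ hc', one_smul] at h
    intro z
    have hz : e.repr z 0 • e 0 + e.repr z 1 • e 1 = z := by
      conv_rhs => rw [← e.sum_repr z]
      rw [Fin.sum_univ_two]
    rw [← hz, map_add, map_smul, map_smul]
    exact (L.restrictScalars ℤ_[p]).add_mem ((L.restrictScalars ℤ_[p]).smul_mem _ he0L)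
      ((L.restrictScalars ℤ_[p]).smul_mem _ he1L)
  -- the matrix of `ρ(res τ)`, `τ ∈ I_{ℚ_p}`, in the basis `e` is `(χ_p(τ), c; 0, 1)`
  have hmat : ∀ τ ∈ absInertia (v.adicCompletion ℚ), ∃ c : ℤ_[p],
      LinearMap.toMatrix e e (W.galoisRepTate p (absGaloisRestrict ℚ (v.adicCompletion ℚ) τ)) =
        !![((GaloisRep.cyclotomicCharacter (v.adicCompletion ℚ) p τ : ℤ_[p]ˣ) : ℤ_[p]), c;
           0, 1] := by
    intro τ hτ
    set g := absGaloisRestrict ℚ (v.adicCompletion ℚ) τ with hg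
    set χτ : ℤ_[p] := ((GaloisRep.cyclotomicCharacter (v.adicCompletion ℚ) p τ : ℤ_[p]ˣ) : ℤ_[p])
      with hχτ
    have hcol0 : W.galoisRepTate p g (e 0) = χτ • e 0 := by
      apply hι
      rw [← hιρ, ← hιsmul]
      exact hLχ τ hτ (ι (e 0)) he0L
    have hcol1mem : W.galoisRepTate p g (e 1) - e 1 ∈ LT := by
      rw [hmemLT, map_sub, ← hιρ]
      exact hLq τ hτ (ι (e 1))
    set c := e.repr (W.galoisRepTate p g (e 1) - e 1) 0 with hc
    have hcol1 : W.galoisRepTate p g (e 1) = c • e 0 + e 1 := by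
      have hdiff : c • e 0 = W.galoisRepTate p g (e 1) - e 1 := by
        have h := e.sum_repr (W.galoisRepTate p g (e 1) - e 1)
        rw [Fin.sum_univ_two, hrepr1 _ hcol1mem, zero_smul, add_zero] at h
        exact h
      rw [hdiff, sub_add_cancel]
    refine ⟨c, ?_⟩
    ext i j
    rw [LinearMap.toMatrix_apply]
    fin_cases i <;> fin_cases j <;>
      simp [hcol0, hcol1]
  -- two inertia elements: `χ_p(σ₄) = 1 + p`, `χ_p(σm) = -1`
  have hunit : IsUnit ((1 : ℤ_[p]) + p) := by
    have hmem : -(p : ℤ_[p]) ∈ nonunits ℤ_[p] := by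
      rw [← IsLocalRing.mem_maximalIdeal, PadicInt.maximalIdeal_eq_span_p]
      exact Submodule.neg_mem _ (Ideal.mem_span_singleton_self _)
    have h := IsLocalRing.isUnit_one_sub_self_of_mem_nonunits _ hmem
    rwa [sub_neg_eq_add] at h
  obtain ⟨σ₄, hσ₄I, hσ₄χ⟩ :=
    adicCompletion_rat_exists_mem_absInertia_cyclotomicCharacter_eq p v hpe hunit.unit
  obtain ⟨σm, hσmI, hσmχ⟩ :=
    adicCompletion_rat_exists_mem_absInertia_cyclotomicCharacter_eq p v hpe (-1)
  obtain ⟨b, hb⟩ := hmat σ₄ hσ₄I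
  obtain ⟨d, hd⟩ := hmat σm hσmI
  rw [hσ₄χ, IsUnit.unit_spec] at hb
  rw [hσmχ, Units.val_neg, Units.val_one] at hd
  set g₄ := absGaloisRestrict ℚ (v.adicCompletion ℚ) σ₄ with hg₄
  set gm := absGaloisRestrict ℚ (v.adicCompletion ℚ) σm with hgm
  -- the first-order witness `τ = g₄ gm g₄ gm`: `ρ(τ) = 1 + p (2, *; 0, 0) + p² (1, *; 0, 0)`
  have hτ : LinearMap.toMatrix e e (W.galoisRepTate p (g₄ * gm * g₄ * gm)) =
      1 + (p : ℤ_[p]) • !![2, -(b + d); 0, 0] + ((p : ℤ_[p]) ^ 2) • !![1, -d; 0, 0] := by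
    rw [map_mul (W.galoisRepTate p), map_mul (W.galoisRepTate p), map_mul (W.galoisRepTate p),
      LinearMap.toMatrix_mul, LinearMap.toMatrix_mul, LinearMap.toMatrix_mul, hb, hd, word_eq]
  have h2 : IsUnit (2 : ℤ_[p]) := isUnit_two' hp2
  exact forall_hasSurjectiveModNGaloisRep_of_firstOrderWitness hp2 hsurj e
    !![2, -(b + d); 0, 0] ⟨g₄ * gm * g₄ * gm, !![1, -d; 0, 0], hτ⟩
    (Or.inr (Or.inr (by simpa using h2))) (by rw [Matrix.trace_fin_two_of, add_zero]; exact h2) n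

/-- **Wuthrich 2014, Lemma 20 — the good ordinary case, PROVED** (binder shape of the named fact
`Wuthrich2014.lemma20_surjective_threeAdic_of_semistable`): for `E/ℚ` (globally minimal `W`) with
good ORDINARY reduction at `3` (`3 ∤ N`, `3 ∤ a_3`) and `ρ̄_{E,3}` onto, `ρ̄_{E,3^n}` is onto for every
`n`.  This is exactly the instance of the lemma consumed on class X10 (`p = 3` good ordinary,
`E[3]` irreducible) of the cell `bsd-rank1-residual`.
[cite: Wuthrich2014, Lemma 20 (p. 399)] [cite: Greenberg1991, §2 (p. 214)] -/
theorem forall_hasSurjectiveModNGaloisRep_three_pow_of_goodOrdinary_of_surj [W.IsGloballyMinimal]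
    (hgood : W.HasGoodReductionAtPrime 3) (hord : ¬ (3 : ℤ) ∣ W.frobeniusTrace 3)
    (hsurj : W.HasSurjectiveModNGaloisRep 3) (n : ℕ) :
    W.HasSurjectiveModNGaloisRep (3 ^ n : ℕ) :=
  haveI : Fact (Nat.Prime 3) := ⟨Nat.prime_three⟩
  forall_hasSurjectiveModNGaloisRep_pow_of_goodOrdinary_of_surj W 3 (by decide) hgood hord hsurj n

end WeierstrassCurve

namespace Literature.NumberTheory.EllipticCurves

namespace Kato2004

open WeierstrassCurve

/-- **Kato's (12.5.2) on the good-ordinary locus is the census bit `surj(p)`** (`p` odd): for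
`E/ℚ` (globally minimal `W`) with good ordinary reduction at `p ≠ 2` and `ρ̄_{E,p}` onto, the image
of `Gal(ℚ̄/ℚ(ζ_{p^∞}))` in `GL_{ℤ_p}(T_pE)` contains `SL₂(ℤ_p)` — the printed hypothesis of the
INTEGRAL clause Kato 2004 Thm. 17.4 (3) (p. 273) (whose standing hypothesis 17.1 (i) is precisely
good ordinary reduction at `p`), so on the good-ordinary locus the integral clause's image
hypothesis is decided by `ρ̄_{E,p}` alone.  From
`forall_hasSurjectiveModNGaloisRep_pow_of_goodOrdinary_of_surj` and the cell's equivalence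
`imageContainsSL2_of_forall_hasSurjectiveModNGaloisRep`.
[cite: Kato2004Asterisque, (12.5.2) in Thm. 12.5 (4) (p. 222); Thm. 17.4 (3) (p. 273)]
[cite: Wuthrich2014, Lemma 20 (p. 399)] -/
theorem imageContainsSL2_of_goodOrdinary_of_surj (W : WeierstrassCurve ℚ) [W.IsElliptic]
    [W.IsGloballyMinimal] (p : ℕ) [Fact p.Prime] (hp2 : p ≠ 2)
    (hgood : W.HasGoodReductionAtPrime p) (hord : ¬ (p : ℤ) ∣ W.frobeniusTrace p)
    (hsurj : W.HasSurjectiveModNGaloisRep p) : ImageContainsSL2 W p :=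
  imageContainsSL2_of_forall_hasSurjectiveModNGaloisRep W p
    (W.forall_hasSurjectiveModNGaloisRep_pow_of_goodOrdinary_of_surj p hp2 hgood hord hsurj)

end Kato2004

end Literature.NumberTheory.EllipticCurves

/-! ## Appendix (unit `b2b-bsdres-lit-kato` gen 7, second landing): the MULTIPLICATIVE case

At a prime `p ≠ 2` of multiplicative reduction the same argument runs with the Tate line in place
of the Serre–Tate line: the transport of `E(K̄)` to the Tate form of invariant `j(E)` over `K̄_v`
(`MultiplicativeReductionInertiaShapeProofs`, equivariant for the inertia group since the twist is
unramified for `p ≠ 2`) exhibits, at every level `p^m`, the kernel of reduction as a subgroup of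
order `≤ p^m` modulo which inertia acts trivially; passing to `T_pE = lim E[p^m]` gives a saturated
inertia-stable `ℤ_p`-line with trivial inertia action on the quotient, and `det ρ_{E,p} = χ_p`
identifies the action on the line.  Hence (`forall_hasSurjectiveModNGaloisRep_pow_of_multiplicative_of_surj`)
`ρ̄_{E,p}` onto ⟹ `ρ̄_{E,p^n}` onto for all `n` at every odd MULTIPLICATIVE prime as well, and
Wuthrich's Lemma 20 is a tree theorem OFF the good-supersingular locus
(`forall_hasSurjectiveModNGaloisRep_three_pow_of_not_additive_of_not_supersingular`): what the named
fact `Wuthrich2014.lemma20_surjective_threeAdic_of_semistable` still carries alone is the case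
`3 ∤ N`, `3 ∣ a_3` (good supersingular reduction at `3`).
-/

namespace WeierstrassCurve

open Literature.NumberTheory.EllipticCurves Literature.NumberTheory.GaloisRepresentations
  NumberField IsDedekindDomain

/-! ### The multiplicative case: the kernel of reduction of the Tate form at `v ∣ p`, all levels -/

section Multiplicative

open scoped NNReal Pointwise
open IsDedekindDomain.HeightOneSpectrum ValuativeRel
  Literature.NumberTheory.GaloisRepresentations.IsNonarchimedeanLocalField
  Literature.NumberTheory.GaloisRepresentations.ModPGaloisRep

/-- **The kernel of reduction of the Tate form at a multiplicative `v ∣ p` (`p` odd), at every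
level `p^m`.**  For an elliptic curve `E` over a number field `K`, an odd prime `p` and a finite
place `v ∣ p` of multiplicative reduction there is a subgroup `R ≤ E(K̄)` (the points whose image on
the Tate form of invariant `j(E)` over `K̄_v` reduces to `O`) such that (i) every subgroup of
`E[p^m]` contained in `R` has at most `p^m` elements, and (ii) `τ P - P ∈ R` for every `P ∈ E[p^m]`
and every `τ` in the inertia group of `K_v` (acting through `absGaloisRestrict K K_v`).  This is the
level-`p^m` form of `exists_line_le_geomTorsion_of_hasMultiplicativeReductionAt`
(`MultiplicativeReductionInertiaShapeProofs`, level `p`), with the SAME proof: the transport to the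
Tate form is equivariant for the inertia group (unramified twist, `p ≠ 2`), every isometry moves the
`p`-power torsion of a Tate form into the kernel of reduction
(`TateForm.one_lt_valuation_of_map_sub_eq_some_of_zsmul_eq_zero`), and a finite subgroup of the
kernel of reduction killed by `p^m` has at most `p^m` elements (`TateForm.card_addSubgroup_le_pow`).
On the Tate curve: `Γ` acts on `E_q[p^m]/μ_{p^m}` trivially (Serre 1968, IV A.1.2–A.1.3).
[cite: SerreInventiones1972, §1.12, Cor. of Prop. 13] [cite: SerreAbelianLadic1968, IV A.1.2] -/
theorem exists_kernelOfReduction_of_hasMultiplicativeReductionAt {K : Type} [Field K] [NumberField K]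
    (W : WeierstrassCurve K) [W.IsElliptic] {v : HeightOneSpectrum (𝓞 K)} {p : ℕ} [hp : Fact p.Prime]
    (hp2 : p ≠ 2) (hpv : (p : 𝓞 K) ∈ v.asIdeal) (hmult : W.HasMultiplicativeReductionAt v) :
    ∃ R : AddSubgroup (geomPoints W),
      (∀ (m : ℕ) (X : AddSubgroup (geomPoints W)), X ≤ geomTorsion W ((p ^ m : ℕ) : ℤ) → X ≤ R →
        Nat.card X ≤ p ^ m) ∧
      ∀ τ ∈ absInertia (v.adicCompletion K), ∀ (m : ℕ), ∀ P ∈ geomTorsion W ((p ^ m : ℕ) : ℤ),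
        absGaloisRestrict K (v.adicCompletion K) τ • P - P ∈ R := by
  obtain ⟨w, hw⟩ := v.exists_spectralValuation
  obtain ⟨𝔐, h𝔐⟩ := v.localPrimesAbove_nonempty
  have hvw : w.Integers w.integer := Valuation.integer.integers w
  -- the Tate form of invariant `j` over `K_v`
  have hjw : 1 < w (algebraMap K (AlgebraicClosure (v.adicCompletion K)) W.j) :=
    W.one_lt_spectralValuation_j_of_hasMultiplicativeReductionAt hw hmult
  obtain ⟨hj0, hj1728, hT, ha₆, -, -⟩ := W.isTateForm_tateFormOfJ_of_one_lt hjw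
  set jv : (v.adicCompletion K) := algebraMap K (v.adicCompletion K) W.j with hjv
  haveI hTell : (tateFormOfJ jv).IsElliptic := isElliptic_tateFormOfJ hj0 hj1728
  haveI : CharZero (v.adicCompletion K) := charZero_of_injective_algebraMap (algebraMap K (v.adicCompletion K)).injective
  have hjW : (W.baseChange (v.adicCompletion K)).j = jv := W.map_j _
  have hjE : (W.baseChange (v.adicCompletion K)).j = (tateFormOfJ jv).j := by
    rw [hjW, tateFormOfJ_j hj0 hj1728]
  have hjE0 : (W.baseChange (v.adicCompletion K)).j ≠ 0 := by rw [hjW]; exact hj0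
  have hjE1728 : (W.baseChange (v.adicCompletion K)).j ≠ 1728 := by rw [hjW]; exact hj1728
  -- the twisting isomorphism with its parameter
  obtain ⟨e, u, hu0, ⟨r, hr0, hur⟩, he⟩ := exists_addEquiv_baseChange_of_j_eq_map_algEquiv_c₄c₆
    (W.baseChange (v.adicCompletion K)) (tateFormOfJ jv) (AlgebraicClosure (v.adicCompletion K)) hjE hjE0 hjE1728
  set f := algebraMap (v.adicCompletion K) (AlgebraicClosure (v.adicCompletion K)) with hf
  -- (1) the minimal model `X = C • E_{K_v}` has unit `c₄`, `c₆`; so has the Tate form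
  obtain ⟨C, hC⟩ : ∃ C : VariableChange (v.adicCompletion K), W.localMinimalModel v = C • W.baseChange (v.adicCompletion K) :=
    ⟨_, rfl⟩
  set I := W.localMinimalIntegralModel v with hIdef
  obtain ⟨hΔm, hc₄m⟩ := (hasMultiplicativeReductionAt_iff_mem v W).mp hmult
  have hc₄u : IsUnit I.c₄ := by
    by_contra h
    exact hc₄m ((IsLocalRing.mem_maximalIdeal _).mpr (mem_nonunits_iff.mpr h))
  have hc₆u : IsUnit I.c₆ := by
    by_contra h
    have hc₆m : I.c₆ ∈ IsLocalRing.maximalIdeal _ :=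
      (IsLocalRing.mem_maximalIdeal _).mpr (mem_nonunits_iff.mpr h)
    apply hc₄m
    refine Ideal.IsPrime.mem_of_pow_mem inferInstance 3 ?_
    rw [show I.c₄ ^ 3 = I.c₆ ^ 2 + 1728 * I.Δ by linear_combination -I.c_relation]
    exact Ideal.add_mem _ (Ideal.pow_mem_of_mem _ hc₆m 2 two_pos) (Ideal.mul_mem_left _ _ hΔm)
  have hXI : I.baseChange (v.adicCompletion K) = W.localMinimalModel v :=
    baseChange_integralModel_eq (v.adicCompletionIntegers K) (W.localMinimalModel v)
  have hXc₄ : (W.localMinimalModel v).c₄ = algebraMap _ (v.adicCompletion K) I.c₄ := by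
    rw [← hXI]; exact (I.map_c₄ _)
  have hXc₆ : (W.localMinimalModel v).c₆ = algebraMap _ (v.adicCompletion K) I.c₆ := by
    rw [← hXI]; exact (I.map_c₆ _)
  have hwc₄ : w (f (W.localMinimalModel v).c₄) = 1 := by
    rw [hXc₄]; exact spectralValuation_eq_one_of_isUnit hw hc₄u
  have hwc₆ : w (f (W.localMinimalModel v).c₆) = 1 := by
    rw [hXc₆]; exact spectralValuation_eq_one_of_isUnit hw hc₆u
  have hEc₄ : (W.baseChange (v.adicCompletion K)).c₄ = (C.u : (v.adicCompletion K)) ^ 4 * (W.localMinimalModel v).c₄ := by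
    rw [hC, variableChange_c₄, Units.val_inv_eq_inv_val, ← mul_assoc, ← mul_pow,
      mul_inv_cancel₀ C.u.ne_zero, one_pow, one_mul]
  have hEc₆ : (W.baseChange (v.adicCompletion K)).c₆ = (C.u : (v.adicCompletion K)) ^ 6 * (W.localMinimalModel v).c₆ := by
    rw [hC, variableChange_c₆, Units.val_inv_eq_inv_val, ← mul_assoc, ← mul_pow,
      mul_inv_cancel₀ C.u.ne_zero, one_pow, one_mul]
  have hTc₄ : w (f (tateFormOfJ jv).c₄) = 1 := by
    rw [hf, ← map_c₄]; exact hT.valuation_c₄ w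
  have hTc₆ : w (f (tateFormOfJ jv).c₆) = 1 := by
    rw [hf, ← map_c₆]; exact hT.valuation_c₆ w
  have hXc₄0 : (W.localMinimalModel v).c₄ ≠ 0 := fun h0 ↦ by
    rw [h0, map_zero, Valuation.map_zero] at hwc₄; exact zero_ne_one hwc₄
  have hTc₆0 : (tateFormOfJ jv).c₆ ≠ 0 := fun h0 ↦ by
    rw [h0, map_zero, Valuation.map_zero] at hTc₆; exact zero_ne_one hTc₆
  have hXc₆0 : (W.localMinimalModel v).c₆ ≠ 0 := fun h0 ↦ by
    rw [h0, map_zero, Valuation.map_zero] at hwc₆; exact zero_ne_one hwc₆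
  have hTc₄0 : (tateFormOfJ jv).c₄ ≠ 0 := fun h0 ↦ by
    rw [h0, map_zero, Valuation.map_zero] at hTc₄; exact zero_ne_one hTc₄
  -- (2) the unit `u' = u · r⁻¹ · u_C⁻¹` with `u'² = c₆(X) c₄(T) / (c₄(X) c₆(T))`; so `|u'| = 1`
  set u' : (AlgebraicClosure (v.adicCompletion K)) := u * f (r⁻¹ * (C.u : (v.adicCompletion K))⁻¹) with hu'
  have hu'2 : u' ^ 2 = f ((W.localMinimalModel v).c₆ * (tateFormOfJ jv).c₄ /
      ((W.localMinimalModel v).c₄ * (tateFormOfJ jv).c₆)) := by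
    rw [hu', mul_pow, hur, ← map_pow, ← map_mul, hEc₄, hEc₆]
    congr 1
    have hCu : (C.u : (v.adicCompletion K)) ≠ 0 := C.u.ne_zero
    field_simp
  have hwu' : w u' = 1 := by
    have h2 : w u' ^ 2 = 1 := by
      rw [← Valuation.map_pow, hu'2, map_div₀, map_mul, map_mul, Valuation.map_div,
        Valuation.map_mul, Valuation.map_mul, hwc₆, hTc₄, hwc₄, hTc₆]
      simp
    exact (pow_eq_one_iff.mp h2).resolve_right two_ne_zero
  -- (3) every inertia element fixes `u`
  have h2w : w (2 : (AlgebraicClosure (v.adicCompletion K))) = 1 := by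
    have := spectralValuation_intCast_eq_one hw (two_not_mem_asIdeal_of_prime_mem hp.out hp2 hpv)
    simpa using this
  have hfixu : ∀ σ ∈ 𝔐.inertia (absoluteGaloisGroup (v.adicCompletion K)),
      absoluteGaloisGroup.toAlgEquiv (v.adicCompletion K) σ u = u := by
    intro σ hσ
    set σE : (AlgebraicClosure (v.adicCompletion K)) ≃ₐ[(v.adicCompletion K)] (AlgebraicClosure (v.adicCompletion K)) := absoluteGaloisGroup.toAlgEquiv _ σ with hσE
    rcases (he σE).1 with hfix | hneg
    · exact hfix
    · exfalso
      have hσu' : σE u' = -u' := by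
        rw [hu', map_mul, hneg, AlgEquiv.commutes, neg_mul]
      have hlt := (mem_inertia_iff_spectralValuation hw h𝔐).mp hσ u' hwu'.le
      have heq : σ • u' - u' = -(2 * u') := by
        change σE u' - u' = -(2 * u')
        rw [hσu']; ring
      rw [heq, Valuation.map_neg, Valuation.map_mul, h2w, hwu', one_mul] at hlt
      exact lt_irrefl _ hlt
  -- (4) the transport `Ψ : E(K̄) → T(K̄_v)`, equivariant for the inertia group
  haveI hint : ((tateFormOfJ jv).baseChange (AlgebraicClosure (v.adicCompletion K))).IsIntegral w.integer := by
    refine isIntegral_integer_of_val_le_one ?_ ?_ ?_ (hT.w_a₄_le.trans hT.w_a₆_lt.le)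
      hT.w_a₆_lt.le
    · rw [hT.a₁, map_one]
    · rw [hT.a₂, map_zero]; exact zero_le_one
    · rw [hT.a₃, map_zero]; exact zero_le_one
  let Φ : localPoints W (v.adicCompletion K) ≃+ ((tateFormOfJ jv).baseChange (AlgebraicClosure (v.adicCompletion K))).toAffine.Point :=
    (Affine.Point.congrEquiv (baseChange_baseChange_adicCompletion W v).symm).trans e
  have hΦ : ∀ σ ∈ 𝔐.inertia (absoluteGaloisGroup (v.adicCompletion K)), ∀ Q : localPoints W (v.adicCompletion K),
      Φ (σ • Q) = Affine.Point.map ((absoluteGaloisGroup.toAlgEquiv (v.adicCompletion K) σ : (AlgebraicClosure (v.adicCompletion K)) ≃ₐ[(v.adicCompletion K)] (AlgebraicClosure (v.adicCompletion K))) :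
        (AlgebraicClosure (v.adicCompletion K)) →ₐ[(v.adicCompletion K)] (AlgebraicClosure (v.adicCompletion K))) (Φ Q) := by
    intro σ hσ Q
    change e (Affine.Point.congrEquiv (baseChange_baseChange_adicCompletion W v).symm (σ • Q)) =
      Affine.Point.map ((absoluteGaloisGroup.toAlgEquiv (v.adicCompletion K) σ : (AlgebraicClosure (v.adicCompletion K)) ≃ₐ[(v.adicCompletion K)] (AlgebraicClosure (v.adicCompletion K))) : (AlgebraicClosure (v.adicCompletion K)) →ₐ[(v.adicCompletion K)] (AlgebraicClosure (v.adicCompletion K)))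
        (e (Affine.Point.congrEquiv (baseChange_baseChange_adicCompletion W v).symm Q))
    rw [congrEquiv_smul, (he _).2, if_pos (hfixu σ hσ)]
  set Ψ : geomPoints W →+ ((tateFormOfJ jv).baseChange (AlgebraicClosure (v.adicCompletion K))).toAffine.Point :=
    Φ.toAddMonoidHom.comp (pointsMap W (v.adicCompletion K)) with hΨ
  have hΨinj : Function.Injective Ψ :=
    Φ.injective.comp (pointsMapOfEmb_injective W (closureEmb (K := K) (v.adicCompletion K)))
  -- the `𝒪_w`-model of the Tate form and the kernel of reduction
  obtain ⟨M, hM⟩ := hint.integral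

  set R : AddSubgroup (geomPoints W) :=
    { carrier := {P | M.ReducesToZero (Affine.Point.congrEquiv hM (Ψ P))}
      zero_mem' := by
        simp only [Set.mem_setOf_eq, map_zero]
        exact reducesToZero_zero
      add_mem' := by
        intro P Q hP hQ
        simp only [Set.mem_setOf_eq, map_add] at hP hQ ⊢
        exact hP.add hvw hQ
      neg_mem' := by
        intro P hP
        simp only [Set.mem_setOf_eq, map_neg] at hP ⊢
        exact hP.neg } with hRdef
  have hmemR : ∀ P : geomPoints W,
      P ∈ R ↔ M.ReducesToZero (Affine.Point.congrEquiv hM (Ψ P)) := fun P ↦ Iff.rfl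
  have hpL : (p : (AlgebraicClosure (v.adicCompletion K))) ≠ 0 := by
    rw [← map_natCast (algebraMap K (AlgebraicClosure (v.adicCompletion K))) p]
    exact (map_ne_zero_iff _ (algebraMap K (AlgebraicClosure (v.adicCompletion K))).injective).mpr (Nat.cast_ne_zero.mpr hp.out.ne_zero)
  have hpw : w (p : (AlgebraicClosure (v.adicCompletion K))) < 1 := spectralValuation_natCast_lt_one hw hpv
  refine ⟨R, ?_, ?_⟩
  · -- (i) a subgroup of `E[p^m]` inside `R` has at most `p^m` elements
    intro m X hXtor hXR
    have hpm0 : ((p ^ m : ℕ) : ℤ) ≠ 0 := by exact_mod_cast pow_ne_zero m hp.out.ne_zero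
    haveI : Finite (geomTorsion W ((p ^ m : ℕ) : ℤ)) :=
      finite_torsionPoints_holds W (AlgebraicClosure K) hpm0
    haveI : Finite X := Finite.of_injective (fun x : X ↦ (⟨x.1, hXtor x.2⟩ : geomTorsion W ((p ^ m : ℕ) : ℤ)))
      (fun x y h ↦ Subtype.ext (by simpa using congrArg Subtype.val h))
    set G := X.map Ψ with hG
    have hGfin : (G : Set ((tateFormOfJ jv).baseChange (AlgebraicClosure (v.adicCompletion K))).toAffine.Point).Finite := by
      rw [hG, AddSubgroup.coe_map]
      exact (Set.toFinite _).image Ψ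
    haveI : Finite G := hGfin.to_subtype
    have hcard : Nat.card X = Nat.card G :=
      Nat.card_congr (X.equivMapOfInjective Ψ hΨinj).toEquiv
    rw [hcard]
    refine TateForm.card_addSubgroup_le_pow (tateFormOfJ jv) hT hp2 hpw hpL m G ?_ ?_
    · -- the affine points of `G` lie in the kernel of reduction
      intro x y h hmem
      obtain ⟨P, hP, hPeq⟩ := AddSubgroup.mem_map.mp hmem
      have hP' := (hmemR P).mp (hXR hP)
      rw [hPeq, Affine.Point.congrEquiv_some, reducesToZero_some_iff,
        not_mem_range_iff hvw] at hP'
      exact hP'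
    · intro Q hmem
      obtain ⟨P, hP, rfl⟩ := AddSubgroup.mem_map.mp hmem
      have hP0 : ((p ^ m : ℕ) : ℤ) • P = 0 := (Submodule.mem_torsionBy_iff _ _).mp (hXtor hP)
      rw [← map_zsmul, hP0, map_zero]
  · -- (ii) `τ P - P ∈ R` for `τ ∈ I_{K_v}`, `P ∈ E[p^m]`
    intro τ hτ m P hP
    have hτI : τ ∈ 𝔐.inertia (absoluteGaloisGroup (v.adicCompletion K)) := by
      rwa [inertia_eq_absInertia hw h𝔐]
    set σE : (AlgebraicClosure (v.adicCompletion K)) ≃ₐ[(v.adicCompletion K)] (AlgebraicClosure (v.adicCompletion K)) := absoluteGaloisGroup.toAlgEquiv _ τ with hσE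
    have hσ₁ : ∀ z : (AlgebraicClosure (v.adicCompletion K)), w (σE z) = w z := fun z ↦ spectralValuation_smul hw τ z
    have hΨτ : Ψ (absGaloisRestrict K (v.adicCompletion K) τ • P) = Affine.Point.map (σE : (AlgebraicClosure (v.adicCompletion K)) →ₐ[(v.adicCompletion K)] (AlgebraicClosure (v.adicCompletion K))) (Ψ P) := by
      rw [hΨ, AddMonoidHom.coe_comp, Function.comp_apply, ← resGal_eq_absGaloisRestrict, pointsMap_smul]
      exact hΦ τ hτI _
    rw [hmemR, map_sub, hΨτ]
    have hP0 : ((p ^ m : ℕ) : ℤ) • Ψ P = 0 := by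
      rw [← map_zsmul, (Submodule.mem_torsionBy_iff _ _).mp hP, map_zero]
    rcases hD : Affine.Point.map (σE : (AlgebraicClosure (v.adicCompletion K)) →ₐ[(v.adicCompletion K)] (AlgebraicClosure (v.adicCompletion K))) (Ψ P) - Ψ P with _ | ⟨s, t, hst⟩
    · rw [← Affine.Point.zero_def, map_zero]
      exact reducesToZero_zero
    · have hs : 1 < w s :=
        TateForm.one_lt_valuation_of_map_sub_eq_some_of_zsmul_eq_zero (tateFormOfJ jv) hT ha₆
          hp2 hpw σE hσ₁ (Ψ P) hP0 hD
      rw [Affine.Point.congrEquiv_some, reducesToZero_some_iff, not_mem_range_iff hvw]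
      exact hs

end Multiplicative

variable (W : WeierstrassCurve ℚ) [W.IsElliptic] (p : ℕ) [Fact p.Prime]

/-! ### The multiplicative case of the lifting theorem -/

set_option maxHeartbeats 1600000 in
/-- **Mod-`p` surjectivity lifts to the whole `p`-adic tower at an odd prime of MULTIPLICATIVE
reduction.**  Let `E/ℚ` be given by `W` (elliptic), `p ≠ 2` a prime of multiplicative reduction
(`W.HasMultiplicativeReductionAtPrime p`, split or non-split), and suppose `ρ̄_{E,p}` is onto.  Then
`ρ̄_{E,p^n}` is onto for every `n`.  At `p = 3` this is the multiplicative case of Wuthrich 2014,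
Lemma 20 (p. 399); at `p ≥ 5` it is Serre IV-23.  Proof: the inertia group at `p` acts on `T_pE`
through `(χ_p, *; 0, 1)` in a basis adapted to the Tate line `lim (E[p^m] ∩ E₁)` of the Tate form
(`exists_kernelOfReduction_of_hasMultiplicativeReductionAt`; `det ρ_{E,p} = χ_p`,
`det_galoisRepTate_eq_cyclotomicCharacter`), `χ_p(I_p) = ℤ_pˣ`, and `σ₄σ₋σ₄σ₋` (`χ_p(σ₄) = 1 + p`,
`χ_p(σ₋) = -1`) is a first-order witness (`forall_hasSurjectiveModNGaloisRep_of_firstOrderWitness`).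
[cite: Wuthrich2014, Lemma 20 (p. 399)] [cite: SerreAbelianLadic1968, IV A.1.2–A.1.3 and IV-23 Lemma 3]
[cite: SerreLocalFields1979, Ch. IV §4 Prop. 17] -/
theorem forall_hasSurjectiveModNGaloisRep_pow_of_multiplicative_of_surj
    (hp2 : p ≠ 2) (hmult : W.HasMultiplicativeReductionAtPrime p)
    (hsurj : W.HasSurjectiveModNGaloisRep p) (n : ℕ) :
    W.HasSurjectiveModNGaloisRep (p ^ n : ℕ) := by
  have hp : p.Prime := Fact.out
  have hp0 : (p : ℚ) ≠ 0 := Nat.cast_ne_zero.mpr hp.ne_zero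
  -- the place of `ℚ` at `p`
  set v : HeightOneSpectrum (𝓞 ℚ) := (Rat.HeightOneSpectrum.primesEquiv (R := 𝓞 ℚ)).symm ⟨p, hp⟩
    with hv_def
  have hv : (p : 𝓞 ℚ) ∈ v.asIdeal :=
    (natCast_mem_asIdeal_iff_eq_primesEquiv_symm v hp).mpr rfl
  have hpe : (Rat.HeightOneSpectrum.primesEquiv v : ℕ) = p := by
    rw [hv_def, Equiv.apply_symm_apply]
  have hmultv : W.HasMultiplicativeReductionAt v :=
    (hasMultiplicativeReductionAtPrime_primesEquiv_iff_holds W v p hpe).mp hmult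
  obtain ⟨R, hRcard, hRmove⟩ := exists_kernelOfReduction_of_hasMultiplicativeReductionAt W hp2 hv hmultv
  -- `T_pE`
  haveI : Module.Free ℤ_[p] (W.tateModule p) := module_free_tateModule_holds W p
  haveI : Module.Finite ℤ_[p] (W.tateModule p) := module_finite_tateModule_holds W p
  -- the Tate line `LT = {x | x_m ∈ R for all m}`
  let LT : Submodule ℤ_[p] (W.tateModule p) :=
    { carrier := {x | ∀ m : ℕ, TateModule.proj p m x ∈ R}
      zero_mem' := fun m ↦ by rw [map_zero]; exact R.zero_mem
      add_mem' := fun hx hy m ↦ by rw [map_add]; exact R.add_mem (hx m) (hy m)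
      smul_mem' := fun c x hx m ↦ by
        rw [TateModule.proj_smul]
        exact R.nsmul_mem (hx m) _ }
  have hmemLT : ∀ x : W.tateModule p, x ∈ LT ↔ ∀ m : ℕ, TateModule.proj p m x ∈ R :=
    fun _ ↦ Iff.rfl
  -- (i) inertia moves `T_pE` into `LT`
  have hmove : ∀ τ ∈ absInertia (v.adicCompletion ℚ), ∀ x : W.tateModule p,
      W.galoisRepTate p (absGaloisRestrict ℚ (v.adicCompletion ℚ) τ) x - x ∈ LT := by
    intro τ hτ x
    rw [hmemLT]
    intro m
    rw [map_sub, galoisRepTate_apply_apply, TateModule.proj_smul_of_distribMulAction]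
    exact hRmove τ hτ m _ (proj_tateModule_mem_geomTorsion W p m x)
  -- (ii) `LT` is saturated
  have hsat : ∀ x : W.tateModule p, (p : ℤ_[p]) • x ∈ LT → x ∈ LT := by
    intro x hx
    rw [hmemLT] at hx ⊢
    intro m
    rw [← TateModule.smul_proj_succ, ← TateModule.proj_natCast_smul]
    exact hx (m + 1)
  have hsat' : ∀ (k : ℕ) (x : W.tateModule p), ((p : ℤ_[p]) ^ k) • x ∈ LT → x ∈ LT := by
    intro k
    induction k with
    | zero => intro x hx; rwa [pow_zero, one_smul] at hx
    | succ k ih =>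
      intro x hx
      rw [pow_succ, mul_smul] at hx
      exact hsat x (ih _ hx)
  -- (iii) `LT ≠ T_pE`: `E[p] ⊄ R` since `#E[p] = p² > p`
  have hnotall : ¬ ∀ z : W.tateModule p, z ∈ LT := by
    intro hall
    have hle : geomTorsion W ((p ^ 1 : ℕ) : ℤ) ≤ R := by
      intro P hP
      obtain ⟨a, ha⟩ := proj_surjective_of_isAlgClosed_holds W p 1 hP
      rw [← ha]
      exact (hmemLT a).mp (hall a) 1
    have hcard := hRcard 1 (geomTorsion W ((p ^ 1 : ℕ) : ℤ)) le_rfl hle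
    have hsq : Nat.card (geomTorsion W ((p ^ 1 : ℕ) : ℤ)) = p ^ 2 := by
      have h := card_torsionPoints_eq_sq_holds W (AlgebraicClosure ℚ) (n := p)
        (by exact_mod_cast hp.ne_zero)
      rw [pow_one]
      exact h
    rw [hsq, pow_one] at hcard
    have : p ^ 2 ≤ p ^ 1 := by rw [pow_one]; exact hcard
    exact absurd (Nat.pow_le_pow_iff_right hp.one_lt |>.mp this) (by norm_num)
  -- the global and local cyclotomic characters; `det ρ = χ_p`
  haveI : NeZero (p : ℚ) := ⟨hp0⟩
  have hdet : ∀ τ : absoluteGaloisGroup (v.adicCompletion ℚ),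
      LinearMap.det (W.galoisRepTate p (absGaloisRestrict ℚ (v.adicCompletion ℚ) τ)) =
        ((GaloisRep.cyclotomicCharacter (v.adicCompletion ℚ) p τ : ℤ_[p]ˣ) : ℤ_[p]) := by
    intro τ
    rw [det_galoisRepTate_eq_cyclotomicCharacter W p hp0 (fun n => exists_weilPairing_holds W _),
      cyclotomicCharacter_absGaloisRestrict]
  -- two inertia elements: `χ_p(σ₄) = 1 + p`, `χ_p(σ₋) = -1`
  have hunit : IsUnit ((1 : ℤ_[p]) + p) := by
    have hmem : -(p : ℤ_[p]) ∈ nonunits ℤ_[p] := by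
      rw [← IsLocalRing.mem_maximalIdeal, PadicInt.maximalIdeal_eq_span_p]
      exact Submodule.neg_mem _ (Ideal.mem_span_singleton_self _)
    have h := IsLocalRing.isUnit_one_sub_self_of_mem_nonunits _ hmem
    rwa [sub_neg_eq_add] at h
  obtain ⟨σ₄, hσ₄I, hσ₄χ⟩ :=
    adicCompletion_rat_exists_mem_absInertia_cyclotomicCharacter_eq p v hpe hunit.unit
  obtain ⟨σm, hσmI, hσmχ⟩ :=
    adicCompletion_rat_exists_mem_absInertia_cyclotomicCharacter_eq p v hpe (-1)
  -- (iv) `LT ≠ 0`: `σ₋` does not act trivially (`det = -1 ≠ 1`)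
  obtain ⟨x₁, hx₁LT, hx₁0⟩ : ∃ x ∈ LT, x ≠ 0 := by
    by_contra hnone
    push Not at hnone
    have htriv : ∀ x : W.tateModule p,
        W.galoisRepTate p (absGaloisRestrict ℚ (v.adicCompletion ℚ) σm) x = x := fun x ↦
      sub_eq_zero.mp (hnone _ (hmove σm hσmI x))
    have hone : W.galoisRepTate p (absGaloisRestrict ℚ (v.adicCompletion ℚ) σm) = LinearMap.id :=
      LinearMap.ext htriv
    have h := hdet σm
    rw [hone, LinearMap.det_id, hσmχ, Units.val_neg, Units.val_one] at h
    have h2 : (2 : ℤ_[p]) = 0 := by linear_combination h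
    exact (isUnit_two' hp2).ne_zero h2
  -- (v) its primitive part and an adapted basis
  obtain ⟨k, t₀, hkt₀, ht₀⟩ := exists_pow_smul_eq_not_dvd hx₁0
  have ht₀LT : t₀ ∈ LT := hsat' k t₀ (by rw [hkt₀]; exact hx₁LT)
  let b₀ : Module.Basis (Fin 2) ℤ_[p] (W.tateModule p) :=
    Module.finBasisOfFinrankEq ℤ_[p] (W.tateModule p) (finrank_tateModule_eq_two_holds W p hp0)
  obtain ⟨e, he0⟩ := exists_basis_eq_of_not_dvd b₀ t₀ ht₀
  have he0LT : e 0 ∈ LT := by rw [he0]; exact ht₀LT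
  -- (vi) `LT = ℤ_p e₀`: the second coordinate of an element of `LT` vanishes
  have hrepr1 : ∀ y ∈ LT, e.repr y 1 = 0 := by
    intro y hy
    by_contra hc
    apply hnotall
    have hy' : e.repr y 0 • e 0 + e.repr y 1 • e 1 = y := by
      conv_rhs => rw [← e.sum_repr y]
      rw [Fin.sum_univ_two]
    have h1 : e.repr y 1 • e 1 ∈ LT := by
      rw [eq_sub_of_add_eq' hy']
      exact LT.sub_mem hy (LT.smul_mem _ he0LT)
    -- `e.repr y 1 = u p^j`, so `u • e 1 ∈ LT` by saturation, so `e 1 ∈ LT`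
    have hspec := PadicInt.unitCoeff_spec hc
    set u : ℤ_[p]ˣ := PadicInt.unitCoeff hc with hu
    have hue1 : (u : ℤ_[p]) • e 1 ∈ LT := by
      refine hsat' (e.repr y 1).valuation _ ?_
      rw [smul_smul, mul_comm, ← hspec]
      exact h1
    have he1LT : e 1 ∈ LT := by
      have h := LT.smul_mem ((u⁻¹ : ℤ_[p]ˣ) : ℤ_[p]) hue1
      rwa [smul_smul, Units.inv_mul, one_smul] at h
    intro z
    have hz : e.repr z 0 • e 0 + e.repr z 1 • e 1 = z := by
      conv_rhs => rw [← e.sum_repr z]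
      rw [Fin.sum_univ_two]
    rw [← hz]
    exact LT.add_mem (LT.smul_mem _ he0LT) (LT.smul_mem _ he1LT)
  -- (vii) the matrix of `ρ(res τ)`, `τ ∈ I_{ℚ_p}`, in the basis `e` is `(χ_p(τ), c; 0, 1)`
  have hmat : ∀ τ ∈ absInertia (v.adicCompletion ℚ), ∃ c : ℤ_[p],
      LinearMap.toMatrix e e (W.galoisRepTate p (absGaloisRestrict ℚ (v.adicCompletion ℚ) τ)) =
        !![((GaloisRep.cyclotomicCharacter (v.adicCompletion ℚ) p τ : ℤ_[p]ˣ) : ℤ_[p]), c;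
           0, 1] := by
    intro τ hτ
    set g := absGaloisRestrict ℚ (v.adicCompletion ℚ) τ with hg
    -- column 0: `ρ e₀ = a e₀`
    set a := e.repr (W.galoisRepTate p g (e 0) - e 0) 0 + 1 with ha
    have hcol0 : W.galoisRepTate p g (e 0) = a • e 0 := by
      have hdiff : (a - 1) • e 0 = W.galoisRepTate p g (e 0) - e 0 := by
        have h := e.sum_repr (W.galoisRepTate p g (e 0) - e 0)
        rw [Fin.sum_univ_two, hrepr1 _ (hmove τ hτ (e 0)), zero_smul, add_zero] at h
        rw [ha, add_sub_cancel_right]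
        exact h
      rw [sub_smul, one_smul] at hdiff
      exact (sub_left_inj.mp hdiff).symm
    -- column 1: `ρ e₁ = c e₀ + e₁`
    set c := e.repr (W.galoisRepTate p g (e 1) - e 1) 0 with hc
    have hcol1 : W.galoisRepTate p g (e 1) = c • e 0 + e 1 := by
      have hdiff : c • e 0 = W.galoisRepTate p g (e 1) - e 1 := by
        have h := e.sum_repr (W.galoisRepTate p g (e 1) - e 1)
        rw [Fin.sum_univ_two, hrepr1 _ (hmove τ hτ (e 1)), zero_smul, add_zero] at h
        exact h
      rw [hdiff, sub_add_cancel]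
    have hM : LinearMap.toMatrix e e (W.galoisRepTate p g) = !![a, c; 0, 1] := by
      ext i j
      rw [LinearMap.toMatrix_apply]
      fin_cases i <;> fin_cases j <;> simp [hcol0, hcol1]
    -- `a = det = χ_p(τ)`
    have ha' : a = ((GaloisRep.cyclotomicCharacter (v.adicCompletion ℚ) p τ : ℤ_[p]ˣ) : ℤ_[p]) := by
      have h := hdet τ
      rw [← LinearMap.det_toMatrix e, hM, Matrix.det_fin_two_of] at h
      simpa using h
    exact ⟨c, by rw [hM, ha']⟩
  obtain ⟨b, hb⟩ := hmat σ₄ hσ₄I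
  obtain ⟨d, hd⟩ := hmat σm hσmI
  rw [hσ₄χ, IsUnit.unit_spec] at hb
  rw [hσmχ, Units.val_neg, Units.val_one] at hd
  set g₄ := absGaloisRestrict ℚ (v.adicCompletion ℚ) σ₄ with hg₄
  set gm := absGaloisRestrict ℚ (v.adicCompletion ℚ) σm with hgm
  -- the first-order witness `τ = g₄ g₋ g₄ g₋`
  have hτ : LinearMap.toMatrix e e (W.galoisRepTate p (g₄ * gm * g₄ * gm)) =
      1 + (p : ℤ_[p]) • !![2, -(b + d); 0, 0] + ((p : ℤ_[p]) ^ 2) • !![1, -d; 0, 0] := by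
    rw [map_mul (W.galoisRepTate p), map_mul (W.galoisRepTate p), map_mul (W.galoisRepTate p),
      LinearMap.toMatrix_mul, LinearMap.toMatrix_mul, LinearMap.toMatrix_mul, hb, hd, word_eq]
  have h2 : IsUnit (2 : ℤ_[p]) := isUnit_two' hp2
  exact forall_hasSurjectiveModNGaloisRep_of_firstOrderWitness hp2 hsurj e
    !![2, -(b + d); 0, 0] ⟨g₄ * gm * g₄ * gm, !![1, -d; 0, 0], hτ⟩
    (Or.inr (Or.inr (by simpa using h2))) (by rw [Matrix.trace_fin_two_of, add_zero]; exact h2) n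

/-- **The case `p = 3`, multiplicative reduction** (binder shape of
`Wuthrich2014.lemma20_surjective_threeAdic_of_semistable`): for `E/ℚ` with multiplicative
reduction at `3` and `ρ̄_{E,3}` onto, `ρ̄_{E,3^n}` is onto for every `n` — the instance of Lemma 20
consumed on class X11 at `p = 3` and on the multiplicative twists of the `AdditivePotMult` cells.
[cite: Wuthrich2014, Lemma 20 (p. 399)] [cite: SerreAbelianLadic1968, IV A.1.2–A.1.3] -/
theorem forall_hasSurjectiveModNGaloisRep_three_pow_of_multiplicative_of_surj
    (hmult : W.HasMultiplicativeReductionAtPrime 3) (hsurj : W.HasSurjectiveModNGaloisRep 3) (n : ℕ) :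
    W.HasSurjectiveModNGaloisRep (3 ^ n : ℕ) :=
  haveI : Fact (Nat.Prime 3) := ⟨Nat.prime_three⟩
  forall_hasSurjectiveModNGaloisRep_pow_of_multiplicative_of_surj W 3 (by decide) hmult hsurj n

/-- **Wuthrich 2014, Lemma 20, off the good-supersingular locus — PROVED.**  For `E/ℚ` (globally
minimal `W`) whose reduction at `3` is good ORDINARY (`3 ∤ N`, `3 ∤ a_3`) or MULTIPLICATIVE, and with
`ρ̄_{E,3}` onto: `ρ̄_{E,3^n}` is onto for every `n`.  (The lemma's remaining printed case, good
supersingular reduction at `3`, is not proved here.) [cite: Wuthrich2014, Lemma 20 (p. 399)] -/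
theorem forall_hasSurjectiveModNGaloisRep_three_pow_of_not_additive_of_not_supersingular
    [W.IsGloballyMinimal]
    (hred : (W.HasGoodReductionAtPrime 3 ∧ ¬ (3 : ℤ) ∣ W.frobeniusTrace 3) ∨
      W.HasMultiplicativeReductionAtPrime 3)
    (hsurj : W.HasSurjectiveModNGaloisRep 3) (n : ℕ) : W.HasSurjectiveModNGaloisRep (3 ^ n : ℕ) := by
  rcases hred with ⟨hgood, hord⟩ | hmult
  · exact W.forall_hasSurjectiveModNGaloisRep_three_pow_of_goodOrdinary_of_surj hgood hord hsurj n
  · exact W.forall_hasSurjectiveModNGaloisRep_three_pow_of_multiplicative_of_surj hmult hsurj n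

end WeierstrassCurve

namespace Literature.NumberTheory.EllipticCurves

namespace Kato2004

open WeierstrassCurve

/-- **Kato's (12.5.2) at an odd multiplicative prime is the census bit `surj(p)`**: for `E/ℚ` with
multiplicative reduction at `p ≠ 2` and `ρ̄_{E,p}` onto, the image of `Gal(ℚ̄/ℚ(ζ_{p^∞}))` in
`GL_{ℤ_p}(T_pE)` contains `SL₂(ℤ_p)` (the hypothesis of the integral divisibilities of Kato's Euler
system in the multiplicative setting of Skinner 2016 §2–3 / Wuthrich 2014 Cor. 19).
[cite: Kato2004Asterisque, (12.5.2) in Thm. 12.5 (4) (p. 222)] [cite: Wuthrich2014, Cor. 19 and Lemma 20 (p. 399)] -/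
theorem imageContainsSL2_of_multiplicative_of_surj (W : WeierstrassCurve ℚ) [W.IsElliptic]
    (p : ℕ) [Fact p.Prime] (hp2 : p ≠ 2) (hmult : W.HasMultiplicativeReductionAtPrime p)
    (hsurj : W.HasSurjectiveModNGaloisRep p) : ImageContainsSL2 W p :=
  imageContainsSL2_of_forall_hasSurjectiveModNGaloisRep W p
    (W.forall_hasSurjectiveModNGaloisRep_pow_of_multiplicative_of_surj p hp2 hmult hsurj)

end Kato2004

end Literature.NumberTheory.EllipticCurves

/-! ## Appendix B (unit `b2b-bsdres-lit-kato` gen 7, third landing): the inertia-triangular basis as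
a standalone statement, and DESCENT ALONG QUADRATIC TWISTS (additive potentially-ordinary `p`)

The two proofs above construct, for `W'/ℚ` with good ordinary or multiplicative reduction at `p`, a
`ℤ_p`-basis of `T_pW'` in which every element of the inertia group at `p` acts as `(χ_p, *; 0, 1)`.
Appendix B records that construction as a statement (`exists_basis_inertia_upperTriangular_of_
{goodOrdinary,multiplicative}`) and draws the consequence for a curve `W` that is only a QUADRATIC
TWIST of such a `W'` (additive, potentially good-ordinary with `e = 2`, or potentially
multiplicative at `p` — the cells (G-ord, `e = 2`) and (M) of the classes X3/X4 of the cell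
`bsd-rank1-residual`): if `f : W'(ℚ̄) ≃+ W(ℚ̄)` commutes with the SQUARES of all `σ ∈ Γ_ℚ` (a
quadratic-twist isomorphism does: `f(σP) = ±σf(P)`, tree theorem
`exists_addEquiv_geomPoints_quadraticTwist_signed`), then for `σ₀ ∈ I_p` with `χ_p(σ₀) = p - 1` the
square `σ₀²` acts on `T_pW'` — hence, transported by `T_pf`, on `T_pW` — as
`(p-1, c; 0, 1)² = 1 + p·(-2, c; 0, 0) + p²·(1, 0; 0, 0)`, a first-order witness; so `ρ̄_{W,p}` onto ⟹
`ρ̄_{W,p^n}` onto for all `n` (`forall_hasSurjectiveModNGaloisRep_pow_of_sqEquivariant_of_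
{goodOrdinary,multiplicative}`, and the model-of-a-twist forms `…_of_twistModel_…`).  No hypothesis on
the reduction of `W` itself at `p`.
-/

namespace WeierstrassCurve

open Literature.NumberTheory.EllipticCurves Literature.NumberTheory.GaloisRepresentations
  NumberField IsDedekindDomain

section AppendixB

/-- `(q-1, c; 0, 1)² = 1 + q·(-2, c; 0, 0) + q²·(1, 0; 0, 0)`. [folklore] -/
private theorem word_sq_eq {R : Type*} [CommRing R] (q c : R) :
    !![q - 1, c; 0, 1] * !![q - 1, c; 0, 1] =
      1 + q • !![-2, c; 0, 0] + q ^ 2 • !![1, 0; 0, 0] := by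
  ext i j
  fin_cases i <;> fin_cases j <;>
    simp [Matrix.mul_apply, Fin.sum_univ_two, Matrix.add_apply] <;> ring

variable (W : WeierstrassCurve ℚ) [W.IsElliptic] (p : ℕ) [Fact p.Prime]

set_option maxHeartbeats 800000 in
/-- **An inertia-triangular basis at a good ORDINARY `v ∣ p`.**  For `E/ℚ` (`W` elliptic), `v` the
place at `p`, good ordinary reduction at `v` (`W.HasGoodReductionAt v`, `p ∤ a_v`): there is a
`ℤ_p`-basis of `T_pE` in which every `τ` of the inertia group `I_{ℚ_v}` acts as `(χ_p(τ), c_τ; 0, 1)`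
(Serre–Tate line; the construction inside `forall_hasSurjectiveModNGaloisRep_pow_of_goodOrdinary_of_surj`,
recorded as a statement). [cite: Greenberg1991, §2 (p. 214)] [cite: SerreInventiones1972, §1.11 Prop. 11 and Cor.] -/
theorem exists_basis_inertia_upperTriangular_of_goodOrdinary (v : HeightOneSpectrum (𝓞 ℚ))
    (hv : (p : 𝓞 ℚ) ∈ v.asIdeal) (hgoodv : W.HasGoodReductionAt v)
    (hordv : ¬ ((p : ℤ) ∣ W.frobeniusTraceAt v)) :
    ∃ e : Module.Basis (Fin 2) ℤ_[p] (W.tateModule p), ∀ τ ∈ absInertia (v.adicCompletion ℚ),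
      ∃ c : ℤ_[p],
        LinearMap.toMatrix e e (W.galoisRepTate p (absGaloisRestrict ℚ (v.adicCompletion ℚ) τ)) =
          !![((GaloisRep.cyclotomicCharacter (v.adicCompletion ℚ) p τ : ℤ_[p]ˣ) : ℤ_[p]), c;
             0, 1] := by
  have hp : p.Prime := Fact.out
  have hp0 : (p : ℚ) ≠ 0 := Nat.cast_ne_zero.mpr hp.ne_zero
  obtain ⟨L, hL1, -, hLχ, hLq⟩ :=
    ellipticOrdinaryReduction_tateModule_filtration_holds W p v hv hgoodv hordv
  -- `T_pE ↪ V_pE` and its compatibilities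
  let ι : W.tateModule p →ₗ[ℤ_[p]] W.rationalTateModule p := TateModule.toRational p
  have hι : Function.Injective ι := TateModule.toRational_injective
  have hιρ : ∀ (g : absoluteGaloisGroup ℚ) (x : W.tateModule p),
      W.rationalGaloisRepTate p g (ι x) = ι (W.galoisRepTate p g x) := fun _ _ ↦ rfl
  have hιsmul : ∀ (c : ℤ_[p]) (x : W.tateModule p), (c : ℚ_[p]) • ι x = ι (c • x) := by
    intro c x
    rw [map_smul]
    exact algebraMap_smul ℚ_[p] c (ι x)
  -- the integral line `LT = T_pE ∩ L`
  let LT : Submodule ℤ_[p] (W.tateModule p) := (L.restrictScalars ℤ_[p]).comap ι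
  have hmemLT : ∀ x : W.tateModule p, x ∈ LT ↔ ι x ∈ L := fun _ ↦ Iff.rfl
  have hpQ : ((p : ℤ_[p]) : ℚ_[p]) ≠ 0 := by
    rw [PadicInt.coe_natCast]; exact Nat.cast_ne_zero.mpr hp.ne_zero
  -- `LT` is saturated
  have hsat : ∀ x : W.tateModule p, (p : ℤ_[p]) • x ∈ LT → x ∈ LT := by
    intro x hx
    rw [hmemLT] at hx ⊢
    rw [← hιsmul] at hx
    have h := L.smul_mem ((p : ℤ_[p]) : ℚ_[p])⁻¹ hx
    rwa [smul_smul, inv_mul_cancel₀ hpQ, one_smul] at h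
  have hsat' : ∀ (k : ℕ) (x : W.tateModule p), ((p : ℤ_[p]) ^ k) • x ∈ LT → x ∈ LT := by
    intro k
    induction k with
    | zero => intro x hx; rwa [pow_zero, one_smul] at hx
    | succ k ih =>
      intro x hx
      rw [pow_succ, mul_smul] at hx
      exact hsat x (ih _ hx)
  -- a non-zero element of `LT`
  obtain ⟨x₁, hx₁LT, hx₁0⟩ : ∃ x ∈ LT, x ≠ 0 := by
    haveI : Module.Finite ℚ_[p] L := Module.finite_of_finrank_eq_succ hL1
    let bL : Module.Basis (Fin 1) ℚ_[p] L := Module.finBasisOfFinrankEq ℚ_[p] L hL1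
    have hℓ0 : (bL 0 : W.rationalTateModule p) ≠ 0 := fun h ↦
      bL.ne_zero 0 (Subtype.ext h)
    obtain ⟨N, hN, x, hx⟩ :=
      RationalTateModule.exists_smul_eq_toRational (bL 0 : W.rationalTateModule p)
    have hN' : (N : ℚ_[p]) ≠ 0 := PadicInt.coe_ne_zero.mpr hN
    refine ⟨x, ?_, ?_⟩
    · rw [hmemLT]
      change TateModule.toRational p x ∈ L
      rw [← hx]
      exact L.smul_mem _ (bL 0).2
    · intro hx0
      rw [hx0, LinearMap.map_zero] at hx
      exact hℓ0 ((smul_eq_zero.mp hx).resolve_left hN')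
  -- its primitive part `t₀`
  obtain ⟨k, t₀, hkt₀, ht₀⟩ := exists_pow_smul_eq_not_dvd hx₁0
  have ht₀LT : t₀ ∈ LT := hsat' k t₀ (by rw [hkt₀]; exact hx₁LT)
  -- a basis `e = (t₀, e₁)` of `T_pE`
  haveI : Module.Free ℤ_[p] (W.tateModule p) := module_free_tateModule_holds W p
  haveI : Module.Finite ℤ_[p] (W.tateModule p) := module_finite_tateModule_holds W p
  let b₀ : Module.Basis (Fin 2) ℤ_[p] (W.tateModule p) :=
    Module.finBasisOfFinrankEq ℤ_[p] (W.tateModule p) (finrank_tateModule_eq_two_holds W p hp0)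
  obtain ⟨e, he0⟩ := exists_basis_eq_of_not_dvd b₀ t₀ ht₀
  have he0LT : e 0 ∈ LT := by rw [he0]; exact ht₀LT
  have he0L : ι (e 0) ∈ L := (hmemLT _).mp he0LT
  -- not every lattice vector lies on the line (`dim L = 1 < 2 = dim V_pE`)
  have hV2 : Module.finrank ℚ_[p] (W.rationalTateModule p) = 2 :=
    finrank_rationalTateModule_eq_two_holds W p hp0
  have hnotall : ¬ ∀ z : W.tateModule p, ι z ∈ L := by
    intro hall
    have hLtop : L = ⊤ := by
      refine eq_top_iff.mpr fun w _ ↦ ?_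
      obtain ⟨N, hN, z, hz⟩ := RationalTateModule.exists_smul_eq_toRational w
      have hN' : (N : ℚ_[p]) ≠ 0 := PadicInt.coe_ne_zero.mpr hN
      have hw : w = (N : ℚ_[p])⁻¹ • ι z := by
        rw [← hz, smul_smul, inv_mul_cancel₀ hN', one_smul]
      rw [hw]
      exact L.smul_mem _ (hall z)
    have h2 : Module.finrank ℚ_[p] L = 2 := by rw [hLtop, finrank_top, hV2]
    omega
  -- `LT = ℤ_p e₀`: the second coordinate of an element of `LT` vanishes
  have hrepr1 : ∀ y ∈ LT, e.repr y 1 = 0 := by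
    intro y hy
    by_contra hc
    apply hnotall
    have hy' : e.repr y 0 • e 0 + e.repr y 1 • e 1 = y := by
      conv_rhs => rw [← e.sum_repr y]
      rw [Fin.sum_univ_two]
    have h1 : (e.repr y 1 : ℚ_[p]) • ι (e 1) ∈ L := by
      have hmem : ι (e.repr y 1 • e 1) ∈ L := by
        rw [eq_sub_of_add_eq' hy', map_sub, map_smul]
        exact (L.restrictScalars ℤ_[p]).sub_mem ((hmemLT y).mp hy)
          ((L.restrictScalars ℤ_[p]).smul_mem _ he0L)
      rwa [hιsmul]
    have hc' : (e.repr y 1 : ℚ_[p]) ≠ 0 := PadicInt.coe_ne_zero.mpr hc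
    have he1L : ι (e 1) ∈ L := by
      have h := L.smul_mem ((e.repr y 1 : ℚ_[p]))⁻¹ h1
      rwa [smul_smul, inv_mul_cancel₀ hc', one_smul] at h
    intro z
    have hz : e.repr z 0 • e 0 + e.repr z 1 • e 1 = z := by
      conv_rhs => rw [← e.sum_repr z]
      rw [Fin.sum_univ_two]
    rw [← hz, map_add, map_smul, map_smul]
    exact (L.restrictScalars ℤ_[p]).add_mem ((L.restrictScalars ℤ_[p]).smul_mem _ he0L)
      ((L.restrictScalars ℤ_[p]).smul_mem _ he1L)
  -- the matrix of `ρ(res τ)`, `τ ∈ I_{ℚ_p}`, in the basis `e` is `(χ_p(τ), c; 0, 1)`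
  have hmat : ∀ τ ∈ absInertia (v.adicCompletion ℚ), ∃ c : ℤ_[p],
      LinearMap.toMatrix e e (W.galoisRepTate p (absGaloisRestrict ℚ (v.adicCompletion ℚ) τ)) =
        !![((GaloisRep.cyclotomicCharacter (v.adicCompletion ℚ) p τ : ℤ_[p]ˣ) : ℤ_[p]), c;
           0, 1] := by
    intro τ hτ
    set g := absGaloisRestrict ℚ (v.adicCompletion ℚ) τ with hg
    set χτ : ℤ_[p] := ((GaloisRep.cyclotomicCharacter (v.adicCompletion ℚ) p τ : ℤ_[p]ˣ) : ℤ_[p])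
      with hχτ
    have hcol0 : W.galoisRepTate p g (e 0) = χτ • e 0 := by
      apply hι
      rw [← hιρ, ← hιsmul]
      exact hLχ τ hτ (ι (e 0)) he0L
    have hcol1mem : W.galoisRepTate p g (e 1) - e 1 ∈ LT := by
      rw [hmemLT, map_sub, ← hιρ]
      exact hLq τ hτ (ι (e 1))
    set c := e.repr (W.galoisRepTate p g (e 1) - e 1) 0 with hc
    have hcol1 : W.galoisRepTate p g (e 1) = c • e 0 + e 1 := by
      have hdiff : c • e 0 = W.galoisRepTate p g (e 1) - e 1 := by
        have h := e.sum_repr (W.galoisRepTate p g (e 1) - e 1)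
        rw [Fin.sum_univ_two, hrepr1 _ hcol1mem, zero_smul, add_zero] at h
        exact h
      rw [hdiff, sub_add_cancel]
    refine ⟨c, ?_⟩
    ext i j
    rw [LinearMap.toMatrix_apply]
    fin_cases i <;> fin_cases j <;>
      simp [hcol0, hcol1]
  exact ⟨e, hmat⟩

set_option maxHeartbeats 1600000 in
/-- **An inertia-triangular basis at a MULTIPLICATIVE `v ∣ p` (`p ≠ 2`).**  For `E/ℚ` (`W`
elliptic), `v` the place at `p` (`primesEquiv v = p`), multiplicative reduction at `v`: there is a
`ℤ_p`-basis of `T_pE` in which every `τ ∈ I_{ℚ_v}` acts as `(χ_p(τ), c_τ; 0, 1)` (the Tate line;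
construction of `forall_hasSurjectiveModNGaloisRep_pow_of_multiplicative_of_surj`, recorded as a
statement). [cite: SerreAbelianLadic1968, IV A.1.2–A.1.3] -/
theorem exists_basis_inertia_upperTriangular_of_multiplicative (hp2 : p ≠ 2)
    (v : HeightOneSpectrum (𝓞 ℚ)) (hv : (p : 𝓞 ℚ) ∈ v.asIdeal)
    (hpe : (Rat.HeightOneSpectrum.primesEquiv v : ℕ) = p) (hmultv : W.HasMultiplicativeReductionAt v) :
    ∃ e : Module.Basis (Fin 2) ℤ_[p] (W.tateModule p), ∀ τ ∈ absInertia (v.adicCompletion ℚ),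
      ∃ c : ℤ_[p],
        LinearMap.toMatrix e e (W.galoisRepTate p (absGaloisRestrict ℚ (v.adicCompletion ℚ) τ)) =
          !![((GaloisRep.cyclotomicCharacter (v.adicCompletion ℚ) p τ : ℤ_[p]ˣ) : ℤ_[p]), c;
             0, 1] := by
  have hp : p.Prime := Fact.out
  have hp0 : (p : ℚ) ≠ 0 := Nat.cast_ne_zero.mpr hp.ne_zero
  obtain ⟨R, hRcard, hRmove⟩ := exists_kernelOfReduction_of_hasMultiplicativeReductionAt W hp2 hv hmultv
  -- `T_pE`
  haveI : Module.Free ℤ_[p] (W.tateModule p) := module_free_tateModule_holds W p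
  haveI : Module.Finite ℤ_[p] (W.tateModule p) := module_finite_tateModule_holds W p
  -- the Tate line `LT = {x | x_m ∈ R for all m}`
  let LT : Submodule ℤ_[p] (W.tateModule p) :=
    { carrier := {x | ∀ m : ℕ, TateModule.proj p m x ∈ R}
      zero_mem' := fun m ↦ by rw [map_zero]; exact R.zero_mem
      add_mem' := fun hx hy m ↦ by rw [map_add]; exact R.add_mem (hx m) (hy m)
      smul_mem' := fun c x hx m ↦ by
        rw [TateModule.proj_smul]
        exact R.nsmul_mem (hx m) _ }
  have hmemLT : ∀ x : W.tateModule p, x ∈ LT ↔ ∀ m : ℕ, TateModule.proj p m x ∈ R :=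
    fun _ ↦ Iff.rfl
  -- (i) inertia moves `T_pE` into `LT`
  have hmove : ∀ τ ∈ absInertia (v.adicCompletion ℚ), ∀ x : W.tateModule p,
      W.galoisRepTate p (absGaloisRestrict ℚ (v.adicCompletion ℚ) τ) x - x ∈ LT := by
    intro τ hτ x
    rw [hmemLT]
    intro m
    rw [map_sub, galoisRepTate_apply_apply, TateModule.proj_smul_of_distribMulAction]
    exact hRmove τ hτ m _ (proj_tateModule_mem_geomTorsion W p m x)
  -- (ii) `LT` is saturated
  have hsat : ∀ x : W.tateModule p, (p : ℤ_[p]) • x ∈ LT → x ∈ LT := by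
    intro x hx
    rw [hmemLT] at hx ⊢
    intro m
    rw [← TateModule.smul_proj_succ, ← TateModule.proj_natCast_smul]
    exact hx (m + 1)
  have hsat' : ∀ (k : ℕ) (x : W.tateModule p), ((p : ℤ_[p]) ^ k) • x ∈ LT → x ∈ LT := by
    intro k
    induction k with
    | zero => intro x hx; rwa [pow_zero, one_smul] at hx
    | succ k ih =>
      intro x hx
      rw [pow_succ, mul_smul] at hx
      exact hsat x (ih _ hx)
  -- (iii) `LT ≠ T_pE`: `E[p] ⊄ R` since `#E[p] = p² > p`
  have hnotall : ¬ ∀ z : W.tateModule p, z ∈ LT := by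
    intro hall
    have hle : geomTorsion W ((p ^ 1 : ℕ) : ℤ) ≤ R := by
      intro P hP
      obtain ⟨a, ha⟩ := proj_surjective_of_isAlgClosed_holds W p 1 hP
      rw [← ha]
      exact (hmemLT a).mp (hall a) 1
    have hcard := hRcard 1 (geomTorsion W ((p ^ 1 : ℕ) : ℤ)) le_rfl hle
    have hsq : Nat.card (geomTorsion W ((p ^ 1 : ℕ) : ℤ)) = p ^ 2 := by
      have h := card_torsionPoints_eq_sq_holds W (AlgebraicClosure ℚ) (n := p)
        (by exact_mod_cast hp.ne_zero)
      rw [pow_one]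
      exact h
    rw [hsq, pow_one] at hcard
    have : p ^ 2 ≤ p ^ 1 := by rw [pow_one]; exact hcard
    exact absurd (Nat.pow_le_pow_iff_right hp.one_lt |>.mp this) (by norm_num)
  -- the global and local cyclotomic characters; `det ρ = χ_p`
  haveI : NeZero (p : ℚ) := ⟨hp0⟩
  have hdet : ∀ τ : absoluteGaloisGroup (v.adicCompletion ℚ),
      LinearMap.det (W.galoisRepTate p (absGaloisRestrict ℚ (v.adicCompletion ℚ) τ)) =
        ((GaloisRep.cyclotomicCharacter (v.adicCompletion ℚ) p τ : ℤ_[p]ˣ) : ℤ_[p]) := by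
    intro τ
    rw [det_galoisRepTate_eq_cyclotomicCharacter W p hp0 (fun n => exists_weilPairing_holds W _),
      cyclotomicCharacter_absGaloisRestrict]
  -- two inertia elements: `χ_p(σ₄) = 1 + p`, `χ_p(σ₋) = -1`
  obtain ⟨σm, hσmI, hσmχ⟩ :=
    adicCompletion_rat_exists_mem_absInertia_cyclotomicCharacter_eq p v hpe (-1)
  -- (iv) `LT ≠ 0`: `σ₋` does not act trivially (`det = -1 ≠ 1`)
  obtain ⟨x₁, hx₁LT, hx₁0⟩ : ∃ x ∈ LT, x ≠ 0 := by
    by_contra hnone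
    push Not at hnone
    have htriv : ∀ x : W.tateModule p,
        W.galoisRepTate p (absGaloisRestrict ℚ (v.adicCompletion ℚ) σm) x = x := fun x ↦
      sub_eq_zero.mp (hnone _ (hmove σm hσmI x))
    have hone : W.galoisRepTate p (absGaloisRestrict ℚ (v.adicCompletion ℚ) σm) = LinearMap.id :=
      LinearMap.ext htriv
    have h := hdet σm
    rw [hone, LinearMap.det_id, hσmχ, Units.val_neg, Units.val_one] at h
    have h2 : (2 : ℤ_[p]) = 0 := by linear_combination h
    exact (isUnit_two' hp2).ne_zero h2
  -- (v) its primitive part and an adapted basis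
  obtain ⟨k, t₀, hkt₀, ht₀⟩ := exists_pow_smul_eq_not_dvd hx₁0
  have ht₀LT : t₀ ∈ LT := hsat' k t₀ (by rw [hkt₀]; exact hx₁LT)
  let b₀ : Module.Basis (Fin 2) ℤ_[p] (W.tateModule p) :=
    Module.finBasisOfFinrankEq ℤ_[p] (W.tateModule p) (finrank_tateModule_eq_two_holds W p hp0)
  obtain ⟨e, he0⟩ := exists_basis_eq_of_not_dvd b₀ t₀ ht₀
  have he0LT : e 0 ∈ LT := by rw [he0]; exact ht₀LT
  -- (vi) `LT = ℤ_p e₀`: the second coordinate of an element of `LT` vanishes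
  have hrepr1 : ∀ y ∈ LT, e.repr y 1 = 0 := by
    intro y hy
    by_contra hc
    apply hnotall
    have hy' : e.repr y 0 • e 0 + e.repr y 1 • e 1 = y := by
      conv_rhs => rw [← e.sum_repr y]
      rw [Fin.sum_univ_two]
    have h1 : e.repr y 1 • e 1 ∈ LT := by
      rw [eq_sub_of_add_eq' hy']
      exact LT.sub_mem hy (LT.smul_mem _ he0LT)
    -- `e.repr y 1 = u p^j`, so `u • e 1 ∈ LT` by saturation, so `e 1 ∈ LT`
    have hspec := PadicInt.unitCoeff_spec hc
    set u : ℤ_[p]ˣ := PadicInt.unitCoeff hc with hu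
    have hue1 : (u : ℤ_[p]) • e 1 ∈ LT := by
      refine hsat' (e.repr y 1).valuation _ ?_
      rw [smul_smul, mul_comm, ← hspec]
      exact h1
    have he1LT : e 1 ∈ LT := by
      have h := LT.smul_mem ((u⁻¹ : ℤ_[p]ˣ) : ℤ_[p]) hue1
      rwa [smul_smul, Units.inv_mul, one_smul] at h
    intro z
    have hz : e.repr z 0 • e 0 + e.repr z 1 • e 1 = z := by
      conv_rhs => rw [← e.sum_repr z]
      rw [Fin.sum_univ_two]
    rw [← hz]
    exact LT.add_mem (LT.smul_mem _ he0LT) (LT.smul_mem _ he1LT)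
  -- (vii) the matrix of `ρ(res τ)`, `τ ∈ I_{ℚ_p}`, in the basis `e` is `(χ_p(τ), c; 0, 1)`
  have hmat : ∀ τ ∈ absInertia (v.adicCompletion ℚ), ∃ c : ℤ_[p],
      LinearMap.toMatrix e e (W.galoisRepTate p (absGaloisRestrict ℚ (v.adicCompletion ℚ) τ)) =
        !![((GaloisRep.cyclotomicCharacter (v.adicCompletion ℚ) p τ : ℤ_[p]ˣ) : ℤ_[p]), c;
           0, 1] := by
    intro τ hτ
    set g := absGaloisRestrict ℚ (v.adicCompletion ℚ) τ with hg
    -- column 0: `ρ e₀ = a e₀`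
    set a := e.repr (W.galoisRepTate p g (e 0) - e 0) 0 + 1 with ha
    have hcol0 : W.galoisRepTate p g (e 0) = a • e 0 := by
      have hdiff : (a - 1) • e 0 = W.galoisRepTate p g (e 0) - e 0 := by
        have h := e.sum_repr (W.galoisRepTate p g (e 0) - e 0)
        rw [Fin.sum_univ_two, hrepr1 _ (hmove τ hτ (e 0)), zero_smul, add_zero] at h
        rw [ha, add_sub_cancel_right]
        exact h
      rw [sub_smul, one_smul] at hdiff
      exact (sub_left_inj.mp hdiff).symm
    -- column 1: `ρ e₁ = c e₀ + e₁`
    set c := e.repr (W.galoisRepTate p g (e 1) - e 1) 0 with hc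
    have hcol1 : W.galoisRepTate p g (e 1) = c • e 0 + e 1 := by
      have hdiff : c • e 0 = W.galoisRepTate p g (e 1) - e 1 := by
        have h := e.sum_repr (W.galoisRepTate p g (e 1) - e 1)
        rw [Fin.sum_univ_two, hrepr1 _ (hmove τ hτ (e 1)), zero_smul, add_zero] at h
        exact h
      rw [hdiff, sub_add_cancel]
    have hM : LinearMap.toMatrix e e (W.galoisRepTate p g) = !![a, c; 0, 1] := by
      ext i j
      rw [LinearMap.toMatrix_apply]
      fin_cases i <;> fin_cases j <;> simp [hcol0, hcol1]
    -- `a = det = χ_p(τ)`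
    have ha' : a = ((GaloisRep.cyclotomicCharacter (v.adicCompletion ℚ) p τ : ℤ_[p]ˣ) : ℤ_[p]) := by
      have h := hdet τ
      rw [← LinearMap.det_toMatrix e, hM, Matrix.det_fin_two_of] at h
      simpa using h
    exact ⟨c, by rw [hM, ha']⟩
  exact ⟨e, hmat⟩

set_option maxHeartbeats 800000 in
/-- **Descent of the tower along a square-equivariant isomorphism.**  Let `W, W'/ℚ` be elliptic,
`p ≠ 2`, `v` the place at `p`, `e'` a `ℤ_p`-basis of `T_pW'` in which `I_{ℚ_v}` acts as
`(χ_p, *; 0, 1)`, and `f : W'(ℚ̄) ≃+ W(ℚ̄)` an additive isomorphism commuting with `σ²` for every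
`σ ∈ Γ_ℚ`.  If `ρ̄_{W,p}` is onto then `ρ̄_{W,p^n}` is onto for every `n`: for `σ₀ ∈ I_{ℚ_v}` with
`χ_p(σ₀) = p - 1`, `σ₀²` acts on `T_pW'`, hence (transport by `T_pf`) on `T_pW`, as
`1 + p·(-2, c; 0, 0) + p²·(1, 0; 0, 0)` — a first-order witness for
`forall_hasSurjectiveModNGaloisRep_of_firstOrderWitness`.
[cite: SerreAbelianLadic1968, Ch. IV §3.4, Lemma 3 (IV-23)] [cite: SerreLocalFields1979, Ch. IV §4 Prop. 17] -/
theorem forall_hasSurjectiveModNGaloisRep_of_upperTriangular_of_sqEquivariant (hp2 : p ≠ 2)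
    (W' : WeierstrassCurve ℚ) (v : HeightOneSpectrum (𝓞 ℚ))
    (hpe : (Rat.HeightOneSpectrum.primesEquiv v : ℕ) = p)
    (e' : Module.Basis (Fin 2) ℤ_[p] (W'.tateModule p))
    (htri : ∀ τ ∈ absInertia (v.adicCompletion ℚ), ∃ c : ℤ_[p],
      LinearMap.toMatrix e' e' (W'.galoisRepTate p (absGaloisRestrict ℚ (v.adicCompletion ℚ) τ)) =
        !![((GaloisRep.cyclotomicCharacter (v.adicCompletion ℚ) p τ : ℤ_[p]ˣ) : ℤ_[p]), c; 0, 1])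
    (f : W'.geomPoints ≃+ W.geomPoints)
    (hf : ∀ (σ : absoluteGaloisGroup ℚ) (P : W'.geomPoints), f ((σ * σ) • P) = (σ * σ) • f P)
    (hsurj : W.HasSurjectiveModNGaloisRep p) (n : ℕ) : W.HasSurjectiveModNGaloisRep (p ^ n : ℕ) := by
  -- an inertia element with `χ_p(σ₀) = p - 1`
  have hu : IsUnit ((p : ℤ_[p]) - 1) := by
    have hmem : (p : ℤ_[p]) ∈ nonunits ℤ_[p] := by
      rw [← IsLocalRing.mem_maximalIdeal, PadicInt.maximalIdeal_eq_span_p]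
      exact Ideal.mem_span_singleton_self _
    have h := (IsLocalRing.isUnit_one_sub_self_of_mem_nonunits _ hmem).neg
    rwa [neg_sub] at h
  obtain ⟨σ₀, hσ₀I, hσ₀χ⟩ :=
    adicCompletion_rat_exists_mem_absInertia_cyclotomicCharacter_eq p v hpe hu.unit
  obtain ⟨c, hc⟩ := htri σ₀ hσ₀I
  rw [hσ₀χ, IsUnit.unit_spec] at hc
  set g₀ := absGaloisRestrict ℚ (v.adicCompletion ℚ) σ₀ with hg₀
  have hsq : LinearMap.toMatrix e' e' (W'.galoisRepTate p (g₀ * g₀)) =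
      1 + (p : ℤ_[p]) • !![-2, c; 0, 0] + ((p : ℤ_[p]) ^ 2) • !![1, 0; 0, 0] := by
    rw [map_mul (W'.galoisRepTate p), LinearMap.toMatrix_mul, hc, word_sq_eq]
  -- transport along `Φ = T_p f : T_pW' ≃ T_pW`
  let Φ : W'.tateModule p ≃ₗ[ℤ_[p]] W.tateModule p :=
    LinearEquiv.ofLinear (TateModule.map p f.toAddMonoidHom) (TateModule.map p f.symm.toAddMonoidHom)
      (by
        rw [← TateModule.map_comp]
        convert TateModule.map_id (A := W.geomPoints) (p := p) using 2
        ext x; simp)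
      (by
        rw [← TateModule.map_comp]
        convert TateModule.map_id (A := W'.geomPoints) (p := p) using 2
        ext x; simp)
  have hΦapply : ∀ x, Φ x = TateModule.map p f.toAddMonoidHom x := fun _ ↦ rfl
  have hΦρ : ∀ x : W'.tateModule p,
      Φ (W'.galoisRepTate p (g₀ * g₀) x) = W.galoisRepTate p (g₀ * g₀) (Φ x) := by
    intro x
    rw [hΦapply, hΦapply]
    refine TateModule.ext fun m ↦ ?_
    rw [TateModule.proj_map, galoisRepTate_apply_apply, galoisRepTate_apply_apply,
      TateModule.proj_smul_of_distribMulAction, TateModule.proj_smul_of_distribMulAction,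
      TateModule.proj_map]
    exact hf g₀ _
  let e : Module.Basis (Fin 2) ℤ_[p] (W.tateModule p) := e'.map Φ
  have hmat : LinearMap.toMatrix e e (W.galoisRepTate p (g₀ * g₀)) =
      LinearMap.toMatrix e' e' (W'.galoisRepTate p (g₀ * g₀)) := by
    ext i j
    rw [LinearMap.toMatrix_apply, LinearMap.toMatrix_apply, Module.Basis.map_apply, ← hΦρ,
      Module.Basis.map_repr, LinearEquiv.trans_apply, LinearEquiv.symm_apply_apply]
  have h2 : IsUnit (-2 : ℤ_[p]) := (isUnit_two' hp2).neg
  exact forall_hasSurjectiveModNGaloisRep_of_firstOrderWitness hp2 hsurj e !![-2, c; 0, 0]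
    ⟨g₀ * g₀, !![1, 0; 0, 0], by rw [hmat, hsq]⟩ (Or.inr (Or.inr (by simpa using h2)))
    (by rw [Matrix.trace_fin_two_of, add_zero]; exact h2) n

/-- **Tower descent from a GOOD-ORDINARY twist.**  Let `W, W'/ℚ` be elliptic, `W'` globally minimal
with good ORDINARY reduction at the odd prime `p` (`p ∤ N'`, `p ∤ a_p(W')`), and
`f : W'(ℚ̄) ≃+ W(ℚ̄)` an additive isomorphism commuting with all squares `σ²`, `σ ∈ Γ_ℚ` (e.g. a
quadratic-twist isomorphism).  Then `ρ̄_{W,p}` onto ⟹ `ρ̄_{W,p^n}` onto for every `n` — with NO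
hypothesis on the reduction of `W` at `p` (the case of an additive, potentially good-ordinary prime
with `e = 2`). [cite: Greenberg1991, §2 (p. 214)] [cite: SerreAbelianLadic1968, Ch. IV §3.4, Lemma 3 (IV-23)] -/
theorem forall_hasSurjectiveModNGaloisRep_pow_of_sqEquivariant_of_goodOrdinary (hp2 : p ≠ 2)
    (W' : WeierstrassCurve ℚ) [W'.IsElliptic] [W'.IsGloballyMinimal]
    (hgood : W'.HasGoodReductionAtPrime p) (hord : ¬ (p : ℤ) ∣ W'.frobeniusTrace p)
    (f : W'.geomPoints ≃+ W.geomPoints)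
    (hf : ∀ (σ : absoluteGaloisGroup ℚ) (P : W'.geomPoints), f ((σ * σ) • P) = (σ * σ) • f P)
    (hsurj : W.HasSurjectiveModNGaloisRep p) (n : ℕ) : W.HasSurjectiveModNGaloisRep (p ^ n : ℕ) := by
  have hp : p.Prime := Fact.out
  set v : HeightOneSpectrum (𝓞 ℚ) := (Rat.HeightOneSpectrum.primesEquiv (R := 𝓞 ℚ)).symm ⟨p, hp⟩
    with hv_def
  have hv : (p : 𝓞 ℚ) ∈ v.asIdeal :=
    (natCast_mem_asIdeal_iff_eq_primesEquiv_symm v hp).mpr rfl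
  have hpe : (Rat.HeightOneSpectrum.primesEquiv v : ℕ) = p := by
    rw [hv_def, Equiv.apply_symm_apply]
  have hgoodv : W'.HasGoodReductionAt v :=
    (hasGoodReductionAtPrime_primesEquiv_iff_holds W' v p hpe).mp hgood
  have hordv : ¬ ((p : ℤ) ∣ W'.frobeniusTraceAt v) := by
    rw [frobeniusTraceAt_eq_frobeniusTrace, hpe]; exact hord
  obtain ⟨e', htri⟩ := W'.exists_basis_inertia_upperTriangular_of_goodOrdinary p v hv hgoodv hordv
  exact W.forall_hasSurjectiveModNGaloisRep_of_upperTriangular_of_sqEquivariant p hp2 W' v hpe e'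
    htri f hf hsurj n

/-- **Tower descent from a MULTIPLICATIVE twist.**  Let `W, W'/ℚ` be elliptic, `W'` with
multiplicative reduction at the odd prime `p`, and `f : W'(ℚ̄) ≃+ W(ℚ̄)` an additive isomorphism
commuting with all squares `σ²`, `σ ∈ Γ_ℚ`.  Then `ρ̄_{W,p}` onto ⟹ `ρ̄_{W,p^n}` onto for every `n`
(the case of an additive, potentially multiplicative prime).
[cite: SerreAbelianLadic1968, IV A.1.2–A.1.3 and IV-23 Lemma 3] -/
theorem forall_hasSurjectiveModNGaloisRep_pow_of_sqEquivariant_of_multiplicative (hp2 : p ≠ 2)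
    (W' : WeierstrassCurve ℚ) [W'.IsElliptic] (hmult : W'.HasMultiplicativeReductionAtPrime p)
    (f : W'.geomPoints ≃+ W.geomPoints)
    (hf : ∀ (σ : absoluteGaloisGroup ℚ) (P : W'.geomPoints), f ((σ * σ) • P) = (σ * σ) • f P)
    (hsurj : W.HasSurjectiveModNGaloisRep p) (n : ℕ) : W.HasSurjectiveModNGaloisRep (p ^ n : ℕ) := by
  have hp : p.Prime := Fact.out
  set v : HeightOneSpectrum (𝓞 ℚ) := (Rat.HeightOneSpectrum.primesEquiv (R := 𝓞 ℚ)).symm ⟨p, hp⟩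
    with hv_def
  have hv : (p : 𝓞 ℚ) ∈ v.asIdeal :=
    (natCast_mem_asIdeal_iff_eq_primesEquiv_symm v hp).mpr rfl
  have hpe : (Rat.HeightOneSpectrum.primesEquiv v : ℕ) = p := by
    rw [hv_def, Equiv.apply_symm_apply]
  have hmultv : W'.HasMultiplicativeReductionAt v :=
    (hasMultiplicativeReductionAtPrime_primesEquiv_iff_holds W' v p hpe).mp hmult
  obtain ⟨e', htri⟩ := W'.exists_basis_inertia_upperTriangular_of_multiplicative p hp2 v hv hpe hmultv
  exact W.forall_hasSurjectiveModNGaloisRep_of_upperTriangular_of_sqEquivariant p hp2 W' v hpe e'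
    htri f hf hsurj n

omit [W.IsElliptic] in
/-- A quadratic-twist model `Wd ≅ C • W^{(d)}` comes with an additive isomorphism
`Wd(ℚ̄) ≃+ W(ℚ̄)` commuting with all squares `σ²` (the twisting isomorphism is `±`-equivariant,
`exists_addEquiv_geomPoints_quadraticTwist_signed`, and the substitution `C` is equivariant,
`VariableChange.pointEquivBaseChange_map_algEquiv`). [cite: SilvermanAEC2009, X.5 Cor. 5.4] -/
theorem exists_addEquiv_sqEquivariant_of_twistModel {d : ℚ} (hd : d ≠ 0) {Wd : WeierstrassCurve ℚ}
    (hWd : ∃ C : VariableChange ℚ, C • W.quadraticTwist d = Wd) :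
    ∃ f : Wd.geomPoints ≃+ W.geomPoints,
      ∀ (σ : absoluteGaloisGroup ℚ) (P : Wd.geomPoints), f ((σ * σ) • P) = (σ * σ) • f P := by
  obtain ⟨C, rfl⟩ := hWd
  haveI : NeZero (2 : ℚ) := ⟨two_ne_zero⟩
  obtain ⟨f, hf⟩ := W.exists_addEquiv_geomPoints_quadraticTwist_signed hd
  set g : (W.quadraticTwist d).geomPoints ≃+ (C • W.quadraticTwist d).geomPoints :=
    VariableChange.pointEquivBaseChange (W.quadraticTwist d) C (AlgebraicClosure ℚ) with hg
  have hgσ : ∀ (σ : absoluteGaloisGroup ℚ) (P : (W.quadraticTwist d).geomPoints),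
      g (σ • P) = σ • g P := fun σ P ↦
    VariableChange.pointEquivBaseChange_map_algEquiv (W.quadraticTwist d) C
      (absoluteGaloisGroup.toAlgEquiv ℚ σ) P
  have hgσ' : ∀ (σ : absoluteGaloisGroup ℚ) (Q : (C • W.quadraticTwist d).geomPoints),
      g.symm (σ • Q) = σ • g.symm Q := fun σ Q ↦ by
    apply g.injective
    rw [AddEquiv.apply_symm_apply, hgσ, AddEquiv.apply_symm_apply]
  refine ⟨g.symm.trans f, fun σ Q ↦ ?_⟩
  rw [AddEquiv.trans_apply, AddEquiv.trans_apply, mul_smul, hgσ', hgσ', mul_smul]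
  rcases hf σ with h | h
  · rw [h, h]
  · rw [h, h, smul_neg, neg_neg]

/-- **Tower for a curve whose quadratic twist has good ORDINARY reduction at `p`** (`p ≠ 2`): if some
`ℚ`-model `Wd` of `W^{(d)}` (`d ≠ 0`), globally minimal, has good ordinary reduction at `p`, then
`ρ̄_{W,p}` onto ⟹ `ρ̄_{W,p^n}` onto for all `n`.  (Classes X3/X4, cell (G-ord, `e = 2`): `W` additive
at `p`, `d = p* `.) [cite: Greenberg1991, §2 (p. 214)] [cite: SilvermanAEC2009, X.5 Cor. 5.4] -/
theorem forall_hasSurjectiveModNGaloisRep_pow_of_twistModel_goodOrdinary (hp2 : p ≠ 2) {d : ℚ}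
    (hd : d ≠ 0) {Wd : WeierstrassCurve ℚ} [Wd.IsElliptic] [Wd.IsGloballyMinimal]
    (hWd : ∃ C : VariableChange ℚ, C • W.quadraticTwist d = Wd)
    (hgood : Wd.HasGoodReductionAtPrime p) (hord : ¬ (p : ℤ) ∣ Wd.frobeniusTrace p)
    (hsurj : W.HasSurjectiveModNGaloisRep p) (n : ℕ) : W.HasSurjectiveModNGaloisRep (p ^ n : ℕ) := by
  obtain ⟨f, hf⟩ := W.exists_addEquiv_sqEquivariant_of_twistModel hd hWd
  exact W.forall_hasSurjectiveModNGaloisRep_pow_of_sqEquivariant_of_goodOrdinary p hp2 Wd hgood hord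
    f hf hsurj n

/-- **Tower for a curve whose quadratic twist has MULTIPLICATIVE reduction at `p`** (`p ≠ 2`): if
some `ℚ`-model `Wd` of `W^{(d)}` (`d ≠ 0`) has multiplicative reduction at `p`, then `ρ̄_{W,p}` onto
⟹ `ρ̄_{W,p^n}` onto for all `n`.  (Classes X3/X4, cell (M): `W` additive potentially multiplicative
at `p`.) [cite: SerreAbelianLadic1968, IV A.1.2–A.1.3] [cite: SilvermanAEC2009, X.5 Cor. 5.4] -/
theorem forall_hasSurjectiveModNGaloisRep_pow_of_twistModel_multiplicative (hp2 : p ≠ 2) {d : ℚ}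
    (hd : d ≠ 0) {Wd : WeierstrassCurve ℚ} [Wd.IsElliptic]
    (hWd : ∃ C : VariableChange ℚ, C • W.quadraticTwist d = Wd)
    (hmult : Wd.HasMultiplicativeReductionAtPrime p)
    (hsurj : W.HasSurjectiveModNGaloisRep p) (n : ℕ) : W.HasSurjectiveModNGaloisRep (p ^ n : ℕ) := by
  obtain ⟨f, hf⟩ := W.exists_addEquiv_sqEquivariant_of_twistModel hd hWd
  exact W.forall_hasSurjectiveModNGaloisRep_pow_of_sqEquivariant_of_multiplicative p hp2 Wd hmult
    f hf hsurj n

end AppendixB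

end WeierstrassCurve
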